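import Literature.Probability.LatticeModels.PlanarIsingOnePoint
import Literature.Probability.LatticeModels.PlanarIsingDiscApprox
import Literature.Probability.LatticeModels.GKSInequalities
import Literature.Probability.LatticeModels.MessagerMiracleSole
import Literature.Probability.LatticeModels.GHSTruncatedPair
import Literature.Analysis.Complex.InjectiveHolomorphic
import HarnessLib

/-!
# CHI Theorem 1.3 for `k = 0` from CHI Theorem 1.1, Proposition 2.20 and Lemma 2.26

Companion to `PlanarIsingOnePoint.lean`, towards the named fact
`Literature.Probability.LatticeModels.chi_onePoint_rho` (Chelkak–Hongler–Izyurov, *Conformal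
invariance of spin correlations in the planar Ising model*, Ann. of Math. 181 (2015) 1087–1138 =
arXiv:1202.2838 (CHI), Thm 1.3 with `k = 0` and eqs. (1.2)–(1.3); numbering of the arXiv version).

CHI prove Thm 1.3 by the induction `T₁ & L₁ ⇒ T₀ ⇒ L₂ ⇒ T₂ ⇒ ⋯` (§2.10, p. 20), where `T_k` is
Thm 1.3 for `k + 1` points (`T₁` = Thm 1.1, the two-point function) and `L_k` is the boundary
decorrelation Lemma 2.26; the step `T₁ & L₁ ⇒ T₀` also uses the convergence of *ratios* of
magnetisations, Prop 2.20 (`k = 0`). This file formalises exactly that step, sorry-free: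

* `tendsto_onePoint_rho_of_CHI` (one domain, one point) and `chi_onePoint_rho_of_CHI` (the named
  fact `chi_onePoint_rho` itself) **from three hypotheses**, which are the published intermediate
  results of CHI in the tree's vocabulary (`meshIsingPlusCorr`, `rhoCHI`, `MeshApproximates`) —
  CHI Thm 1.1 (`+` case, limit (1.2)–(1.3): `twoPointPlusCHI`), CHI Prop 2.20 (`k = 0`, with the
  one-point function (1.2)–(1.3): `onePointPlusCHI`) and the *lower* bound of CHI Lemma 2.26
  (`k = 1`). They are hypotheses (binders), **not** named facts: their printed proofs rest on the
  convergence theory of discrete spinor observables (CHI Thms 1.5, 1.7, §§2.2–2.9, §3), which the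
  tree does not have; this file isolates what remains once they are available.
* `tendsto_onePoint_rho_of_twoPoint` and `chi_onePoint_rho_of_twoPoint` (appended 2026-08-15):
  the same conclusion from **CHI Thm 1.1 alone, in both boundary conditions** (`twoPointPlusCHI`;
  `twoPointFreeCHI` for the free model `meshIsingFreeCorr` on the same discrete domains, with its
  GKS comparisons `meshIsingFreeCorr_two_nonneg`, `meshIsingFreeCorr_two_le_plus`) — Prop 2.20 and
  Lemma 2.26 are dispensed with: the boundary decorrelation is DERIVED as in the printed proof of
  Lemma 2.26 (`k = 1`) from the GHS application `𝔼⁺[σ_xσ_y] - 𝔼⁺[σ_x]𝔼⁺[σ_y] ≤ 𝔼^free[σ_xσ_y]`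
  (`meshIsingPlusCorr_two_sub_mul_le_free`, from `GHSTruncatedPair.lean`) and
  `𝔼^free/𝔼⁺ → 𝓑_Ω(x;y) → 0` (`bCHI`, `eventually_decorr_of_bCHI_lt`, CHI Remark 2.23), and the
  ratio of magnetisations is avoided by using two auxiliary points `φ⁻¹(Re φa + it)`,
  `φ⁻¹(Re φa + 1 + it)`: `𝔼[σ_a]² = (𝔼[σ_a]𝔼[σ_d])(𝔼[σ_a]𝔼[σ_{d'}])/(𝔼[σ_d]𝔼[σ_{d'}])`, each product
  being pinched against the corresponding two-point function. (`tendsto_onePoint_rho_core` records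
  the intermediate form of the printed argument needing the decorrelation only along
  `φ(c) = Re φ(a) + it`.)
* Everything else in CHI's argument is **proved** here: the upper bound of Lemma 2.26 (`k = 1`) is
  GKS II (`meshIsingPlusCorr_mul_le_two`, `eventually_mul_le_two`), "positivity of magnetization
  fixes the sign" is GKS I (`meshIsingPlusCorr_one_nonneg`), `ϱ(δ) ≥ 0` (`rhoCHI_nonneg`), the
  marked points are free faces of `Ω_δ` for small `δ` (`eventually_nearestSite_mem_meshInteriorFinset`,
  from the bulk clause of `MeshApproximates` and the cell geometry `mem_of_mem_meshPolygon`),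
  `φ' ≠ 0` for a conformal bijection (`Literature.Analysis.Complex.SCV.deriv_ne_zero_of_injOn`),
  the choice of the auxiliary point `c = φ⁻¹(Re φ(a) + it)` close to `∂Ω`
  (`exists_im_lt_imp_infDist_lt`, compactness), the boundary decorrelation of the explicit
  functions `⟨σ_aσ_c⟩⁺_Ω / (⟨σ_a⟩⁺_Ω ⟨σ_c⟩⁺_Ω) = √((u + u⁻¹)/2) → 1` (CHI §2.7;
  `twoPointPlusCHI_eq_mul_ratioCHI`, `tendsto_ratioCHI_vertical`), and the squeeze of p. 20
  (`tendsto_of_ratio_squeeze`).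

Lattice conventions are those of `PlanarIsingOnePoint.lean` (module docstring there): CHI's
`ϱ`-normalised statements are scale-free, so no constant changes under the transport from CHI's
`45°`-rotated face lattice to `δℤ²`.

## References

* D. Chelkak, C. Hongler, K. Izyurov, *Conformal invariance of spin correlations in the planar
  Ising model*, Ann. of Math. (2) 181 (2015), 1087–1138; arXiv:1202.2838: Thm 1.1, Thm 1.3,
  Thm 1.7, eqs. (1.2)–(1.3), Prop 2.20, Lemma 2.22, Remark 2.23, Lemma 2.26, §2.7, §2.10 (proofs
  of Lemma 2.26 and Thm 1.3).
* S. Friedli, Y. Velenik, *Statistical Mechanics of Lattice Systems*, CUP (2017), Thm 3.20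
  (GKS inequalities).
-/

noncomputable section

open MeasureTheory Filter Topology Real Metric Set
open Literature.Probability.LatticeModels
open scoped symmDiff

namespace Literature.Probability.LatticeModels

/-! ### CHI's explicit continuum correlation functions (1.3), transported by (1.2) -/

/-- CHI's continuum one-point function of a bounded simply connected `Ω`, written through a
conformal bijection `φ : Ω → ℍ` by the covariance (1.2) and the half-plane value (1.3):
`⟨σ_a⟩⁺_Ω = ⟨σ_{φ a}⟩⁺_ℍ · |φ'(a)|^{1/8} = 2^{1/4} · |φ'(a)|^{1/8} · (2 Im φ(a))^{-1/8}`
(the target value of `chi_onePoint_rho`). [cite: ChelkakHonglerIzyurovAnnals2015, eqs. (1.2)–(1.3)] -/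
def onePointPlusCHI (φ : ℂ → ℂ) (a : ℂ) : ℝ :=
  (2 : ℝ) ^ ((1 : ℝ) / 4) * ‖deriv φ a‖ ^ ((1 : ℝ) / 8) * (2 * (φ a).im) ^ (-(1 : ℝ) / 8)

/-- CHI's cross-ratio modulus `u_{ab} := |(b - a) / (b - ā)|^{1/2}` of two points of `ℍ`
(eq. (1.3)). [cite: ChelkakHonglerIzyurovAnnals2015, eq. (1.3)] -/
def uCHI (w₁ w₂ : ℂ) : ℝ :=
  (‖w₂ - w₁‖ / ‖w₂ - (starRingEnd ℂ) w₁‖) ^ ((1 : ℝ) / 2)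

/-- CHI's continuum two-point function with `+` boundary conditions, written through a conformal
bijection `φ : Ω → ℍ` by the covariance (1.2) and the half-plane formula (1.3):
`⟨σ_aσ_b⟩⁺_Ω = ⟨σ_{φa}σ_{φb}⟩⁺_ℍ · |φ'(a)|^{1/8} |φ'(b)|^{1/8}`,
`⟨σ_aσ_b⟩⁺_ℍ = √(u_{ab} + u_{ab}⁻¹) / ((2 Im a)^{1/8} (2 Im b)^{1/8})` (the limit in CHI Thm 1.1,
`+` case). [cite: ChelkakHonglerIzyurovAnnals2015, Thm. 1.1 with eqs. (1.2)–(1.3)] -/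
def twoPointPlusCHI (φ : ℂ → ℂ) (a b : ℂ) : ℝ :=
  Real.sqrt (uCHI (φ a) (φ b) + (uCHI (φ a) (φ b))⁻¹) /
      ((2 * (φ a).im) ^ ((1 : ℝ) / 8) * (2 * (φ b).im) ^ ((1 : ℝ) / 8)) *
    (‖deriv φ a‖ ^ ((1 : ℝ) / 8) * ‖deriv φ b‖ ^ ((1 : ℝ) / 8))

/-- The ratio `⟨σ_aσ_b⟩⁺_ℍ / (⟨σ_a⟩⁺_ℍ ⟨σ_b⟩⁺_ℍ) = √((u_{ab} + u_{ab}⁻¹)/2)` of CHI's half-plane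
functions (1.3) (a conformal invariant; it tends to `1` as `b → ∂ℍ`, CHI §2.7).
[cite: ChelkakHonglerIzyurovAnnals2015, eq. (1.3) and §2.7] -/
def ratioCHI (w₁ w₂ : ℂ) : ℝ :=
  Real.sqrt ((uCHI w₁ w₂ + (uCHI w₁ w₂)⁻¹) / 2)

/-- CHI's continuum two-point function with **free** boundary conditions, written through a
conformal bijection `φ : Ω → ℍ` by the covariance (1.2) (Remark 1.2 (ii): `⟨σ_aσ_b⟩^free_Ω` is a
conformal covariant of degree `1/8` in each variable) and the half-plane formula (1.3):
`⟨σ_aσ_b⟩^free_ℍ = √(u_{ab}⁻¹ - u_{ab}) / ((2 Im a)^{1/8} (2 Im b)^{1/8})` (the limit in CHI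
Thm 1.1, free case). [cite: ChelkakHonglerIzyurovAnnals2015, Thm. 1.1 with eqs. (1.2)–(1.3)] -/
def twoPointFreeCHI (φ : ℂ → ℂ) (a b : ℂ) : ℝ :=
  Real.sqrt ((uCHI (φ a) (φ b))⁻¹ - uCHI (φ a) (φ b)) /
      ((2 * (φ a).im) ^ ((1 : ℝ) / 8) * (2 * (φ b).im) ^ ((1 : ℝ) / 8)) *
    (‖deriv φ a‖ ^ ((1 : ℝ) / 8) * ‖deriv φ b‖ ^ ((1 : ℝ) / 8))

/-- CHI's conformal invariant `𝓑_Ω(a;b) = ⟨σ_aσ_b⟩^free_Ω / ⟨σ_aσ_b⟩⁺_Ω` (Thm 1.7), in the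
half-plane: `𝓑_ℍ(a;b) = √(u⁻¹ - u) / √(u + u⁻¹)`, `u = u_{ab}` (from (1.3)); it tends to `0` as
`b → ∂ℍ` (CHI Remark 2.23, "`𝓑_Ω(a;b) → 0` as `a → ∂Ω`").
[cite: ChelkakHonglerIzyurovAnnals2015, Thm. 1.7 and eq. (1.3), Remark 2.23] -/
def bCHI (w₁ w₂ : ℂ) : ℝ :=
  Real.sqrt ((uCHI w₁ w₂)⁻¹ - uCHI w₁ w₂) / Real.sqrt (uCHI w₁ w₂ + (uCHI w₁ w₂)⁻¹)

/-- `u_{ab} ≥ 0`. [cite: ChelkakHonglerIzyurovAnnals2015, eq. (1.3)] -/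
theorem uCHI_nonneg (w₁ w₂ : ℂ) : 0 ≤ uCHI w₁ w₂ := by
  unfold uCHI; positivity

/-- `u_{ab} > 0` for `b ≠ a, ā`. [cite: ChelkakHonglerIzyurovAnnals2015, eq. (1.3)] -/
theorem uCHI_pos {w₁ w₂ : ℂ} (h₁ : w₂ ≠ w₁) (h₂ : w₂ ≠ (starRingEnd ℂ) w₁) : 0 < uCHI w₁ w₂ := by
  unfold uCHI
  apply Real.rpow_pos_of_pos
  exact div_pos (norm_pos_iff.2 (sub_ne_zero.2 h₁)) (norm_pos_iff.2 (sub_ne_zero.2 h₂))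

/-- `⟨σ_aσ_b⟩⁺_ℍ ≥ ⟨σ_a⟩⁺_ℍ ⟨σ_b⟩⁺_ℍ` for the explicit functions (1.3), i.e.
`√((u + u⁻¹)/2) ≥ 1` (`u > 0`; the continuum shadow of GKS II). [cite: ChelkakHonglerIzyurovAnnals2015, eq. (1.3)] -/
theorem one_le_ratioCHI {w₁ w₂ : ℂ} (h₁ : w₂ ≠ w₁) (h₂ : w₂ ≠ (starRingEnd ℂ) w₁) :
    1 ≤ ratioCHI w₁ w₂ := by
  have hu := uCHI_pos h₁ h₂
  unfold ratioCHI
  rw [Real.le_sqrt' one_pos, one_pow, le_div_iff₀ (by norm_num : (0 : ℝ) < 2)]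
  -- `2 ≤ u + u⁻¹`
  have h : 0 ≤ (uCHI w₁ w₂ - 1) ^ 2 / uCHI w₁ w₂ := by positivity
  have key : (uCHI w₁ w₂ - 1) ^ 2 / uCHI w₁ w₂ = uCHI w₁ w₂ + (uCHI w₁ w₂)⁻¹ - 2 := by
    field_simp; ring
  linarith

/-- `⟨σ_a⟩⁺_Ω > 0` at a point where `φ' ≠ 0` and `φ(a) ∈ ℍ`. [cite: ChelkakHonglerIzyurovAnnals2015, eq. (1.3)] -/
theorem onePointPlusCHI_pos {φ : ℂ → ℂ} {a : ℂ} (hd : deriv φ a ≠ 0) (him : 0 < (φ a).im) :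
    0 < onePointPlusCHI φ a := by
  unfold onePointPlusCHI
  have h1 : 0 < ‖deriv φ a‖ := norm_pos_iff.2 hd
  positivity

/-- **Factorisation of CHI's two-point function**:
`⟨σ_aσ_b⟩⁺_Ω = ⟨σ_a⟩⁺_Ω ⟨σ_b⟩⁺_Ω · √((u + u⁻¹)/2)`, `u = u_{φ(a)φ(b)}` (from (1.2)–(1.3)).
[cite: ChelkakHonglerIzyurovAnnals2015, eq. (1.3) and §2.7] -/
theorem twoPointPlusCHI_eq_mul_ratioCHI {φ : ℂ → ℂ} {a b : ℂ} (ha : 0 < (φ a).im) (hb : 0 < (φ b).im) :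
    twoPointPlusCHI φ a b = onePointPlusCHI φ a * onePointPlusCHI φ b * ratioCHI (φ a) (φ b) := by
  unfold twoPointPlusCHI onePointPlusCHI ratioCHI
  set u := uCHI (φ a) (φ b) with hu
  have hu0 : 0 ≤ u := uCHI_nonneg _ _
  have hsum : 0 ≤ u + u⁻¹ := by positivity
  have hA : 0 < (2 * (φ a).im) := by positivity
  have hB : 0 < (2 * (φ b).im) := by positivity
  -- negative powers as inverses
  rw [show (-(1 : ℝ) / 8) = -((1 : ℝ) / 8) by ring, Real.rpow_neg hA.le, Real.rpow_neg hB.le]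
  -- `√(u + u⁻¹) = 2^{1/4} 2^{1/4} √((u + u⁻¹)/2)`
  have h2 : (2 : ℝ) ^ ((1 : ℝ) / 4) * (2 : ℝ) ^ ((1 : ℝ) / 4) = Real.sqrt 2 := by
    rw [← Real.rpow_add (by norm_num : (0 : ℝ) < 2), Real.sqrt_eq_rpow]; norm_num
  have hsq : Real.sqrt (u + u⁻¹) = Real.sqrt 2 * Real.sqrt ((u + u⁻¹) / 2) := by
    rw [← Real.sqrt_mul (by norm_num : (0 : ℝ) ≤ 2)]
    congr 1; ring
  have hpa : 0 < (2 * (φ a).im) ^ ((1 : ℝ) / 8) := Real.rpow_pos_of_pos hA _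
  have hpb : 0 < (2 * (φ b).im) ^ ((1 : ℝ) / 8) := Real.rpow_pos_of_pos hB _
  rw [hsq, ← h2]
  field_simp

/-- **Free over plus is `𝓑`**: `⟨σ_aσ_b⟩^free_Ω = ⟨σ_aσ_b⟩⁺_Ω · 𝓑_ℍ(φa; φb)` for the explicit
functions (1.2)–(1.3) (`b ≠ a`, so that `u > 0`). [cite: ChelkakHonglerIzyurovAnnals2015, eq. (1.3) and Thm. 1.7] -/
theorem twoPointFreeCHI_eq_mul_bCHI {φ : ℂ → ℂ} {a b : ℂ} (h₁ : φ b ≠ φ a)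
    (h₂ : φ b ≠ (starRingEnd ℂ) (φ a)) :
    twoPointFreeCHI φ a b = twoPointPlusCHI φ a b * bCHI (φ a) (φ b) := by
  unfold twoPointFreeCHI twoPointPlusCHI bCHI
  have hu := uCHI_pos h₁ h₂
  have hs : 0 < Real.sqrt (uCHI (φ a) (φ b) + (uCHI (φ a) (φ b))⁻¹) :=
    Real.sqrt_pos.2 (by positivity)
  field_simp

/-- Continuity of `u_{pq}` in both points off the locus `q = p̄` (congruence of limits).
[cite: ChelkakHonglerIzyurovAnnals2015, eq. (1.3)] -/
theorem tendsto_uCHI {α : Type*} {l : Filter α} {f g : α → ℂ} {p q : ℂ}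
    (hf : Tendsto f l (𝓝 p)) (hg : Tendsto g l (𝓝 q)) (hq : q ≠ (starRingEnd ℂ) p) :
    Tendsto (fun t => uCHI (f t) (g t)) l (𝓝 (uCHI p q)) := by
  unfold uCHI
  have hconj : Tendsto (fun t => (starRingEnd ℂ) (f t)) l (𝓝 ((starRingEnd ℂ) p)) :=
    (Complex.continuous_conj.tendsto p).comp hf
  have hden : ‖q - (starRingEnd ℂ) p‖ ≠ 0 := norm_ne_zero_iff.2 (sub_ne_zero.2 hq)
  exact (((hg.sub hf).norm).div ((hg.sub hconj).norm) hden).rpow_const (Or.inr (by norm_num))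

/-- `√((u + u⁻¹)/2) → 1` whenever `u → 1`. [cite: ChelkakHonglerIzyurovAnnals2015, eq. (1.3) and §2.7] -/
theorem tendsto_ratioCHI_of_uCHI {α : Type*} {l : Filter α} {f g : α → ℂ}
    (hu : Tendsto (fun t => uCHI (f t) (g t)) l (𝓝 1)) :
    Tendsto (fun t => ratioCHI (f t) (g t)) l (𝓝 1) := by
  have hsum : Tendsto (fun t => (uCHI (f t) (g t) + (uCHI (f t) (g t))⁻¹) / 2) l (𝓝 1) := by
    have h := (hu.add (hu.inv₀ one_ne_zero)).div_const 2
    rw [inv_one] at h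
    norm_num at h
    exact h
  have := hsum.sqrt
  rw [Real.sqrt_one] at this
  exact this

/-- `𝓑 = √(u⁻¹ - u)/√(u + u⁻¹) → 0` whenever `u → 1` (CHI Remark 2.23).
[cite: ChelkakHonglerIzyurovAnnals2015, Remark 2.23 and eq. (1.3)] -/
theorem tendsto_bCHI_of_uCHI {α : Type*} {l : Filter α} {f g : α → ℂ}
    (hu : Tendsto (fun t => uCHI (f t) (g t)) l (𝓝 1)) :
    Tendsto (fun t => bCHI (f t) (g t)) l (𝓝 0) := by
  have hnum : Tendsto (fun t => Real.sqrt ((uCHI (f t) (g t))⁻¹ - uCHI (f t) (g t))) l (𝓝 0) := by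
    have h := ((hu.inv₀ one_ne_zero).sub hu).sqrt
    rw [inv_one, sub_self, Real.sqrt_zero] at h
    exact h
  have hden : Tendsto (fun t => Real.sqrt (uCHI (f t) (g t) + (uCHI (f t) (g t))⁻¹)) l
      (𝓝 (Real.sqrt 2)) := by
    have h := (hu.add (hu.inv₀ one_ne_zero)).sqrt
    rw [inv_one, show (1 : ℝ) + 1 = 2 by norm_num] at h
    exact h
  have h := hnum.div hden (Real.sqrt_pos.2 two_pos).ne'
  rw [zero_div] at h
  exact h

/-- `u(w, Re w) = 1` (`Im w ≠ 0`): the boundary point straight below `w`. [cite: ChelkakHonglerIzyurovAnnals2015, eq. (1.3)] -/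
theorem uCHI_self_re {w : ℂ} (hw : w.im ≠ 0) : uCHI w (w.re : ℂ) = 1 := by
  unfold uCHI
  have h1 : (w.re : ℂ) - w = ((-w.im : ℝ) : ℂ) * Complex.I := by
    apply Complex.ext <;> simp
  have h2 : (w.re : ℂ) - (starRingEnd ℂ) w = ((w.im : ℝ) : ℂ) * Complex.I := by
    apply Complex.ext <;> simp
  rw [h1, h2, norm_mul, norm_mul, Complex.norm_real, Complex.norm_real, Real.norm_eq_abs,
    Real.norm_eq_abs, abs_neg, div_self (mul_ne_zero (abs_ne_zero.2 hw) (by simp)), Real.one_rpow]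

/-- `u(w, Re w + 1) = 1`: the boundary point one unit to the right. [cite: ChelkakHonglerIzyurovAnnals2015, eq. (1.3)] -/
theorem uCHI_self_re_add_one (w : ℂ) : uCHI w ((w.re : ℂ) + 1) = 1 := by
  unfold uCHI
  have h1 : ((w.re : ℂ) + 1) - w = 1 + ((-w.im : ℝ) : ℂ) * Complex.I := by
    apply Complex.ext <;> simp
  have h2 : ((w.re : ℂ) + 1) - (starRingEnd ℂ) w =
      (starRingEnd ℂ) (1 + ((-w.im : ℝ) : ℂ) * Complex.I) := by
    apply Complex.ext <;> simp
  have hne : (1 : ℂ) + ((-w.im : ℝ) : ℂ) * Complex.I ≠ 0 := by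
    intro h
    have := congrArg Complex.re h
    simp at this
  rw [h1, h2, Complex.norm_conj, div_self (norm_ne_zero_iff.2 hne), Real.one_rpow]

/-- `u(x, x + 1) = 1` for real `x`: two boundary points. [cite: ChelkakHonglerIzyurovAnnals2015, eq. (1.3)] -/
theorem uCHI_re_re_add_one (x : ℝ) : uCHI (x : ℂ) ((x : ℂ) + 1) = 1 := by
  unfold uCHI
  simp [Complex.conj_ofReal]

/-- `u_{ab} → 1` as `b → ∂ℍ` along the vertical path `b = Re a + it`, `t → 0`. [cite: ChelkakHonglerIzyurovAnnals2015, eq. (1.3)] -/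
theorem tendsto_uCHI_vertical {w : ℂ} (hw : 0 < w.im) :
    Tendsto (fun t : ℝ => uCHI w ((w.re : ℂ) + t * Complex.I)) (𝓝 0) (𝓝 1) := by
  have hnum : Tendsto (fun t : ℝ => ‖((w.re : ℂ) + t * Complex.I) - w‖) (𝓝 0) (𝓝 w.im) := by
    have : (fun t : ℝ => ‖((w.re : ℂ) + t * Complex.I) - w‖) = fun t => |t - w.im| := by
      funext t
      have h : ((w.re : ℂ) + t * Complex.I) - w = ((t - w.im : ℝ) : ℂ) * Complex.I := by
        apply Complex.ext <;> simp
      rw [h, norm_mul, Complex.norm_I, mul_one, Complex.norm_real, Real.norm_eq_abs]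
    rw [this]
    have h0 : Tendsto (fun t : ℝ => t - w.im) (𝓝 0) (𝓝 (0 - w.im)) :=
      tendsto_id.sub tendsto_const_nhds
    have := h0.abs
    rwa [zero_sub, abs_neg, abs_of_pos hw] at this
  have hden : Tendsto (fun t : ℝ => ‖((w.re : ℂ) + t * Complex.I) - (starRingEnd ℂ) w‖) (𝓝 0)
      (𝓝 w.im) := by
    have : (fun t : ℝ => ‖((w.re : ℂ) + t * Complex.I) - (starRingEnd ℂ) w‖) =
        fun t => |t + w.im| := by
      funext t
      have h : ((w.re : ℂ) + t * Complex.I) - (starRingEnd ℂ) w = ((t + w.im : ℝ) : ℂ) * Complex.I := by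
        apply Complex.ext <;> simp
      rw [h, norm_mul, Complex.norm_I, mul_one, Complex.norm_real, Real.norm_eq_abs]
    rw [this]
    have h0 : Tendsto (fun t : ℝ => t + w.im) (𝓝 0) (𝓝 (0 + w.im)) :=
      tendsto_id.add tendsto_const_nhds
    have := h0.abs
    rwa [zero_add, abs_of_pos hw] at this
  have h := (hnum.div hden hw.ne').rpow_const (p := (1 : ℝ) / 2) (Or.inr (by norm_num))
  rw [div_self hw.ne', Real.one_rpow] at h
  exact h

/-- **`𝓑 → 0` at the boundary** (CHI Remark 2.23: "`𝓑_Ω(a;b) → 0` as `a → ∂Ω` … follows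
readily from the explicit formulae (1.3) in the half-plane"), along the vertical path
`b = Re a + it`, `t → 0⁺`. [cite: ChelkakHonglerIzyurovAnnals2015, Remark 2.23 and eq. (1.3)] -/
theorem tendsto_bCHI_vertical {w : ℂ} (hw : 0 < w.im) :
    Tendsto (fun t : ℝ => bCHI w ((w.re : ℂ) + t * Complex.I)) (𝓝[>] 0) (𝓝 0) :=
  tendsto_nhdsWithin_of_tendsto_nhds (tendsto_bCHI_of_uCHI (tendsto_uCHI_vertical hw))

/-- **Decorrelation of the explicit half-plane functions at the boundary** (CHI §2.7: "the
multiplicative constants in (1.3) are chosen so that `⟨σ_aσ_b⟩⁺_ℍ ∼ ⟨σ_a⟩⁺_ℍ ⟨σ_b⟩⁺_ℍ` as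
`b → ∂ℍ`"), along the vertical path `b = Re a + i t`, `t → 0⁺`: the ratio tends to `1`.
[cite: ChelkakHonglerIzyurovAnnals2015, §2.7] -/
theorem tendsto_ratioCHI_vertical {w : ℂ} (hw : 0 < w.im) :
    Tendsto (fun t : ℝ => ratioCHI w ((w.re : ℂ) + t * Complex.I)) (𝓝[>] 0) (𝓝 1) :=
  tendsto_nhdsWithin_of_tendsto_nhds (tendsto_ratioCHI_of_uCHI (tendsto_uCHI_vertical hw))

/-- **The squeeze of CHI's proof of Thm 1.3 (`k = 0`), abstract form** (CHI p. 20): if for every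
`η ∈ (0, 1/2]` the quantity `Q` is eventually pinched between `(1 - η) B` and `B` for some `B`
tending to `M · R` with `1 ≤ R ≤ 1 + η`, then `Q → M`. [cite: ChelkakHonglerIzyurovAnnals2015, §2.10, proof of Thm. 1.3] -/
theorem tendsto_of_ratio_squeeze {l : Filter ℝ} {Q : ℝ → ℝ} {M : ℝ} (hM : 0 ≤ M)
    (h : ∀ η : ℝ, 0 < η → η ≤ 1 / 2 → ∃ (B : ℝ → ℝ) (R : ℝ), 1 ≤ R ∧ R ≤ 1 + η ∧
      Tendsto B l (𝓝 (M * R)) ∧ ∀ᶠ δ in l, (1 - η) * B δ ≤ Q δ ∧ Q δ ≤ B δ) :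
    Tendsto Q l (𝓝 M) := by
  rw [Metric.tendsto_nhds]
  intro e he
  set η : ℝ := min (1 / 2) (e / (2 * M + 1)) with hη
  have hη0 : 0 < η := lt_min (by norm_num) (div_pos he (by positivity))
  have hη1 : η ≤ 1 / 2 := min_le_left _ _
  have hη2 : η * (2 * M + 1) ≤ e := by
    have : η ≤ e / (2 * M + 1) := min_le_right _ _
    rwa [le_div_iff₀ (by positivity)] at this
  obtain ⟨B, R, hR1, hR2, hB, hQ⟩ := h η hη0 hη1
  have hκ : 0 < η * (M + 1) := by positivity
  have hBev : ∀ᶠ δ in l, dist (B δ) (M * R) < η * (M + 1) := Metric.tendsto_nhds.1 hB _ hκ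
  filter_upwards [hBev, hQ] with δ hBδ hQδ
  rw [Real.dist_eq, abs_sub_lt_iff] at hBδ ⊢
  obtain ⟨hlo, hhi⟩ := hQδ
  have hMR : M ≤ M * R := le_mul_of_one_le_right hM hR1
  have hMR' : M * R ≤ M * (1 + η) := mul_le_mul_of_nonneg_left hR2 hM
  obtain ⟨hk₁, hk₂⟩ := hBδ
  constructor
  · -- upper bound: `Q ≤ B < M R + η(M+1) ≤ M + η(2M+1)`
    calc Q δ - M ≤ B δ - M := by linarith
      _ < η * (M + 1) + M * R - M := by linarith
      _ ≤ η * (M + 1) + M * (1 + η) - M := by linarith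
      _ = η * (2 * M + 1) := by ring
      _ ≤ e := hη2
  · -- lower bound: `Q ≥ (1-η) B > (1-η)(M R - η(M+1)) ≥ M - η(2M+1)`
    have h1 : (1 - η) * (M * R - η * (M + 1)) < (1 - η) * B δ :=
      mul_lt_mul_of_pos_left (by linarith) (by linarith)
    have h2 : 0 ≤ (M * R - M) * (1 - η) := mul_nonneg (by linarith) (by linarith)
    have h3 : 0 ≤ η ^ 2 * (M + 1) := by positivity
    calc M - Q δ ≤ M - (1 - η) * B δ := by linarith
      _ < M - (1 - η) * (M * R - η * (M + 1)) := by linarith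
      _ = η * (2 * M + 1) - (M * R - M) * (1 - η) - η ^ 2 * (M + 1) := by ring
      _ ≤ η * (2 * M + 1) := by linarith
      _ ≤ e := hη2

/-! ### Lattice input: spin products, GKS, free marked sites -/

section Lattice

/-- `𝔼⁺_{Ω_δ}[σ_a]` is the set-indexed correlation of the singleton `{[a/δ]}`. [folklore] -/
theorem meshIsingPlusCorr_one_eq (Ω : Set ℂ) (δ : ℝ) (a : ℂ) :
    meshIsingPlusCorr Ω δ ![a] =
      isingCorr (discreteDomainGraph Ω δ) (meshInteriorFinset Ω δ) criticalBetaTwo 0 .plus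
        {nearestSite δ a} := by
  unfold meshIsingPlusCorr isingCorr
  congr 1

/-- `𝔼⁺_{Ω_δ}[σ_aσ_c]` is the set-indexed correlation of `{[a/δ], [c/δ]}` when the two rounded
sites differ. [folklore] -/
theorem meshIsingPlusCorr_two_eq (Ω : Set ℂ) (δ : ℝ) {a c : ℂ} (h : nearestSite δ a ≠ nearestSite δ c) :
    meshIsingPlusCorr Ω δ ![a, c] =
      isingCorr (discreteDomainGraph Ω δ) (meshInteriorFinset Ω δ) criticalBetaTwo 0 .plus
        {nearestSite δ a, nearestSite δ c} := by
  unfold meshIsingPlusCorr isingCorr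
  congr 1
  funext s
  simp [spinMonomial, spinProduct, Fin.prod_univ_two, Finset.prod_pair h]

/-- `𝔼⁺_{Ω_δ}[σ_cσ_a] = 𝔼⁺_{Ω_δ}[σ_aσ_c]`. [folklore] -/
theorem meshIsingPlusCorr_two_symm (Ω : Set ℂ) (δ : ℝ) (a c : ℂ) :
    meshIsingPlusCorr Ω δ ![c, a] = meshIsingPlusCorr Ω δ ![a, c] := by
  unfold meshIsingPlusCorr
  congr 1
  funext s
  simp [spinMonomial, Fin.prod_univ_two, mul_comm]

/-- **GKS I for the CHI magnetisation**: `0 ≤ 𝔼⁺_{Ω_δ}[σ_a]` once the rounded site is a free site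
(Griffiths' first inequality in the finite volume `Ω_δ ∖ ∂Ω_δ` with `+` boundary condition,
`β_c > 0`, `h = 0`). [cite: FriedliVelenik2017, Thm. 3.20, eq. (3.21)] -/
theorem meshIsingPlusCorr_one_nonneg {Ω : Set ℂ} {δ : ℝ} {a : ℂ}
    (ha : nearestSite δ a ∈ meshInteriorFinset Ω δ) : 0 ≤ meshIsingPlusCorr Ω δ ![a] := by
  rw [meshIsingPlusCorr_one_eq]
  exact GKSInequalities.gks_one_holds (discreteDomainGraph Ω δ) criticalBetaTwo_pos.le le_rfl
    (Or.inr rfl) (Finset.singleton_subset_iff.2 ha)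

/-- **GKS II for the CHI correlations** (the upper bound of CHI Lemma 2.26, `k = 1`, which CHI
attribute to FKG): `𝔼⁺_{Ω_δ}[σ_a] 𝔼⁺_{Ω_δ}[σ_c] ≤ 𝔼⁺_{Ω_δ}[σ_aσ_c]` once both rounded sites are
free and distinct (Griffiths' second inequality, `σ_{{x}}σ_{{y}} = σ_{{x} ∆ {y}}`).
[cite: FriedliVelenik2017, Thm. 3.20, eq. (3.22)] -/
theorem meshIsingPlusCorr_mul_le_two {Ω : Set ℂ} {δ : ℝ} {a c : ℂ}
    (ha : nearestSite δ a ∈ meshInteriorFinset Ω δ) (hc : nearestSite δ c ∈ meshInteriorFinset Ω δ)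
    (h : nearestSite δ a ≠ nearestSite δ c) :
    meshIsingPlusCorr Ω δ ![a] * meshIsingPlusCorr Ω δ ![c] ≤ meshIsingPlusCorr Ω δ ![a, c] := by
  rw [meshIsingPlusCorr_one_eq, meshIsingPlusCorr_one_eq, meshIsingPlusCorr_two_eq Ω δ h]
  have hsd : ({nearestSite δ a} : Finset (Site 2)) ∆ {nearestSite δ c} =
      {nearestSite δ a, nearestSite δ c} := by
    ext z
    simp only [Finset.mem_symmDiff, Finset.mem_singleton, Finset.mem_insert]
    constructor
    · rintro (⟨h1, -⟩ | ⟨h1, -⟩)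
      · exact Or.inl h1
      · exact Or.inr h1
    · rintro (h1 | h1)
      · exact Or.inl ⟨h1, h1 ▸ h⟩
      · exact Or.inr ⟨h1, h1 ▸ Ne.symm h⟩
  have h2 := GKSInequalities.gks_two_holds (discreteDomainGraph Ω δ) (Λ := meshInteriorFinset Ω δ)
    (A := {nearestSite δ a}) (B := {nearestSite δ c}) (β := criticalBetaTwo) (h := 0)
    (bc := .plus) criticalBetaTwo_pos.le le_rfl (Or.inr rfl) (Finset.singleton_subset_iff.2 ha)
    (Finset.singleton_subset_iff.2 hc)
  rwa [hsd] at h2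

/-- **CHI's normalising factor is nonnegative**: `0 ≤ ϱ(δ)` (GKS I for the plus state of `ℤ²`).
[cite: FriedliVelenik2017, Thm. 3.20, eq. (3.21)] -/
theorem rhoCHI_nonneg (δ : ℝ) : 0 ≤ rhoCHI δ := by
  unfold rhoCHI
  by_cases hx : nearestSite δ ⟨Real.sqrt 2 / 2, Real.sqrt 2 / 2⟩ = 0
  · rw [hx, twoPointPlus_origin]
    exact zero_le_one
  · rw [twoPointPlus_eq_plusCorr_pair _ hx]
    exact plusCorr_nonneg criticalBetaTwo_pos.le le_rfl _

/-- **An interior point of a polygon of cells only meets cells of the polygon**: if `z` lies in the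
(open) polygonal domain of `Λ` and in the closed cell of `y`, then `y ∈ Λ` (cells of distinct sites
have disjoint interiors). [folklore] -/
theorem mem_of_mem_meshPolygon {Λ : Set (Site 2)} {δ : ℝ} (hδ : 0 < δ) {z : ℂ}
    (hz : z ∈ meshPolygon Λ δ) {y : Site 2} (hy : z ∈ meshCell δ y) : y ∈ Λ := by
  by_contra hyΛ
  obtain ⟨r, hr, hball⟩ := Metric.mem_nhds_iff.1 (mem_interior_iff_mem_nhds.1 hz)
  obtain ⟨hy0, hy1⟩ := mem_meshCell_iff.1 hy
  -- move from `z` towards the centre of the cell of `y`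
  set t : ℝ := min (1 / 2) (r / (2 * δ)) with ht
  have ht0 : 0 < t := lt_min (by norm_num) (by positivity)
  have ht1 : t ≤ 1 / 2 := min_le_left _ _
  have ht2 : t * δ ≤ r / 2 := by
    have : t ≤ r / (2 * δ) := min_le_right _ _
    rw [le_div_iff₀ (by positivity)] at this
    linarith
  set z' : ℂ := z + (t : ℂ) * (meshPoint δ y - z) with hz'
  have hre : z'.re - δ * y 0 = (1 - t) * (z.re - δ * y 0) := by
    simp only [hz', Complex.add_re, Complex.mul_re, Complex.ofReal_re, Complex.ofReal_im,
      Complex.sub_re, meshPoint_re, zero_mul, sub_zero]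
    ring
  have him : z'.im - δ * y 1 = (1 - t) * (z.im - δ * y 1) := by
    simp only [hz', Complex.add_im, Complex.mul_im, Complex.ofReal_re, Complex.ofReal_im,
      Complex.sub_im, meshPoint_im, zero_mul, add_zero]
    ring
  -- `z'` is within `r` of `z`
  have hz'ball : z' ∈ Metric.ball z r := by
    rw [Metric.mem_ball, dist_eq_norm]
    have hdiff : z' - z = (t : ℂ) * (meshPoint δ y - z) := by rw [hz']; ring
    rw [hdiff, norm_mul, Complex.norm_real, Real.norm_eq_abs, abs_of_pos ht0]
    have hn : ‖meshPoint δ y - z‖ ≤ δ := by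
      refine (Complex.norm_le_abs_re_add_abs_im _).trans ?_
      have h0 : |(meshPoint δ y - z).re| ≤ δ / 2 := by
        rw [Complex.sub_re, meshPoint_re, abs_sub_comm]; exact hy0
      have h1 : |(meshPoint δ y - z).im| ≤ δ / 2 := by
        rw [Complex.sub_im, meshPoint_im, abs_sub_comm]; exact hy1
      linarith
    calc t * ‖meshPoint δ y - z‖ ≤ t * δ := by gcongr
      _ ≤ r / 2 := ht2
      _ < r := by linarith
  obtain ⟨x, hxΛ, hx⟩ : ∃ x ∈ Λ, z' ∈ meshCell δ x := by
    have := hball hz'ball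
    simpa only [Set.mem_iUnion, exists_prop] using this
  have hxy : x ≠ y := fun h => hyΛ (h ▸ hxΛ)
  -- `z'` lies in the open cell of `y` …
  have hre' : |z'.re - δ * y 0| < δ / 2 := by
    rw [hre, abs_mul, abs_of_nonneg (by linarith)]
    calc (1 - t) * |z.re - δ * y 0| ≤ (1 - t) * (δ / 2) := by gcongr; linarith
      _ < δ / 2 := by nlinarith
  have him' : |z'.im - δ * y 1| < δ / 2 := by
    rw [him, abs_mul, abs_of_nonneg (by linarith)]
    calc (1 - t) * |z.im - δ * y 1| ≤ (1 - t) * (δ / 2) := by gcongr; linarith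
      _ < δ / 2 := by nlinarith
  -- … and in the closed cell of `x ≠ y`: contradiction
  obtain ⟨hx0, hx1⟩ := mem_meshCell_iff.1 hx
  have hcoord : x 0 ≠ y 0 ∨ x 1 ≠ y 1 := by
    by_contra hcon
    push Not at hcon
    exact hxy (by ext i; fin_cases i <;> simp [hcon.1, hcon.2])
  rcases hcoord with h0 | h1
  · have hz1 : (1 : ℤ) ≤ |x 0 - y 0| := Int.one_le_abs (sub_ne_zero.2 h0)
    have hr1 : (1 : ℝ) ≤ |(x 0 : ℝ) - (y 0 : ℝ)| := by exact_mod_cast hz1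
    have key : |δ * x 0 - δ * y 0| < δ := by
      calc |δ * x 0 - δ * y 0| ≤ |δ * x 0 - z'.re| + |z'.re - δ * y 0| := abs_sub_le _ _ _
        _ < δ / 2 + δ / 2 := by rw [abs_sub_comm]; exact add_lt_add_of_le_of_lt hx0 hre'
        _ = δ := by ring
    rw [← mul_sub, abs_mul, abs_of_pos hδ] at key
    nlinarith
  · have hz1 : (1 : ℤ) ≤ |x 1 - y 1| := Int.one_le_abs (sub_ne_zero.2 h1)
    have hr1 : (1 : ℝ) ≤ |(x 1 : ℝ) - (y 1 : ℝ)| := by exact_mod_cast hz1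
    have key : |δ * x 1 - δ * y 1| < δ := by
      calc |δ * x 1 - δ * y 1| ≤ |δ * x 1 - z'.im| + |z'.im - δ * y 1| := abs_sub_le _ _ _
        _ < δ / 2 + δ / 2 := by rw [abs_sub_comm]; exact add_lt_add_of_le_of_lt hx1 him'
        _ = δ := by ring
    rw [← mul_sub, abs_mul, abs_of_pos hδ] at key
    nlinarith

/-- **Marked points are eventually free sites** (the bulk clause of `MeshApproximates`): for
`a ∈ Ω`, the rounded site `[a/δ]` is a free site of `Ω_δ` for all small `δ > 0` (CHI Thms 1.1, 1.3:
the marked points are faces of `Ω_δ`). [cite: ChelkakHonglerIzyurovAnnals2015, §2.1] -/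
theorem eventually_nearestSite_mem_meshInteriorFinset {Ω : Set ℂ} (hM : MeshApproximates Ω)
    {a : ℂ} (ha : a ∈ Ω) : ∀ᶠ δ in 𝓝[>] (0 : ℝ), nearestSite δ a ∈ meshInteriorFinset Ω δ := by
  have h := hM.2.2 {a} isCompact_singleton (Set.singleton_subset_iff.2 ha)
  filter_upwards [h, self_mem_nhdsWithin] with δ hδ hδ0
  have haP : a ∈ meshInteriorPolygon Ω δ := hδ (Set.mem_singleton a)
  have hδ0' : (0 : ℝ) < δ := hδ0
  exact Finset.mem_coe.1 (mem_of_mem_meshPolygon hδ0' haP (mem_meshCell_nearestSite hδ0' a))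

/-- Distinct marked points round to distinct sites for small `δ`. [folklore] -/
theorem eventually_nearestSite_ne {a c : ℂ} (h : a ≠ c) :
    ∀ᶠ δ in 𝓝[>] (0 : ℝ), nearestSite δ a ≠ nearestSite δ c := by
  have hd : 0 < dist a c / 2 := div_pos (dist_pos.2 h) two_pos
  have hev : ∀ᶠ δ in 𝓝[>] (0 : ℝ), δ < dist a c / 2 :=
    mem_nhdsWithin_of_mem_nhds (Iio_mem_nhds hd)
  filter_upwards [hev, self_mem_nhdsWithin] with δ hδ hδ0 heq
  have hδ0' : (0 : ℝ) < δ := hδ0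
  have h1 := dist_meshPoint_nearestSite_le hδ0' a
  have h2 := dist_meshPoint_nearestSite_le hδ0' c
  rw [heq] at h1
  have := dist_triangle_left a c (meshPoint δ (nearestSite δ c))
  linarith

/-- **The upper bound of CHI Lemma 2.26 (`k = 1`), proved**: for an approximable `Ω` and distinct
`a, c ∈ Ω`, `𝔼⁺_{Ω_δ}[σ_a] 𝔼⁺_{Ω_δ}[σ_c] ≤ 𝔼⁺_{Ω_δ}[σ_aσ_c]` for all small `δ > 0` (CHI: "the upper
bound follows readily from FKG"; here from GKS II, once both marked points are free faces and round
to distinct sites). [cite: ChelkakHonglerIzyurovAnnals2015, Lemma 2.26 (upper bound, k = 1)] -/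
theorem eventually_mul_le_two {Ω : Set ℂ} (hM : MeshApproximates Ω) {a c : ℂ} (ha : a ∈ Ω)
    (hc : c ∈ Ω) (hac : a ≠ c) :
    ∀ᶠ δ in 𝓝[>] (0 : ℝ),
      meshIsingPlusCorr Ω δ ![a] * meshIsingPlusCorr Ω δ ![c] ≤ meshIsingPlusCorr Ω δ ![a, c] := by
  filter_upwards [eventually_nearestSite_mem_meshInteriorFinset hM ha,
    eventually_nearestSite_mem_meshInteriorFinset hM hc, eventually_nearestSite_ne hac] with δ hxa hxc hne
  exact meshIsingPlusCorr_mul_le_two hxa hxc hne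

/-- **GKS I for the CHI magnetisation, eventually**: for an approximable `Ω` and `a ∈ Ω`,
`0 ≤ 𝔼⁺_{Ω_δ}[σ_a]` for all small `δ > 0` (CHI, proof of Thm 1.3: "positivity of magnetization
fixes the sign"). [cite: ChelkakHonglerIzyurovAnnals2015, §2.10, proof of Thm. 1.3] -/
theorem eventually_onePoint_nonneg {Ω : Set ℂ} (hM : MeshApproximates Ω) {a : ℂ} (ha : a ∈ Ω) :
    ∀ᶠ δ in 𝓝[>] (0 : ℝ), 0 ≤ meshIsingPlusCorr Ω δ ![a] := by
  filter_upwards [eventually_nearestSite_mem_meshInteriorFinset hM ha] with δ hδ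
  exact meshIsingPlusCorr_one_nonneg hδ

/-- **The discrete critical spin correlation with free boundary conditions** on the same
discrete domain, `𝔼^free_{Ω_δ}[σ_{[a₁/δ]} ⋯ σ_{[aₙ/δ]}]`: the Ising measure of the graph
`Ω_δ = discreteDomainGraph Ω δ` in the volume `meshInteriorFinset Ω δ` (the faces carrying the
unfrozen spins of the `+` model `meshIsingPlusCorr`, whose polygon `meshInteriorPolygon Ω δ` is the
one constrained by `MeshApproximates`) at `β = β_c(2)`, `h = 0`, with the **free** boundary
condition: only the edges between free sites interact (every pair of `ℤ²`-adjacent free sites is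
an edge of `Ω_δ`, by the definition of `meshBoundary`), "no restrictions are set for boundary
spins" (CHI §1.1). This is CHI's `𝔼^free_{Ω_δ}` for the discrete domain whose face set is
`meshInteriorFinset Ω δ`. Same marked-site and junk conventions as `meshIsingPlusCorr`.
[cite: ChelkakHonglerIzyurovAnnals2015, §1.1 and Thm. 1.1 (free boundary conditions)] -/
def meshIsingFreeCorr {n : ℕ} (Ω : Set ℂ) (δ : ℝ) (a : Fin n → ℂ) : ℝ :=
  isingExpect (discreteDomainGraph Ω δ) (meshInteriorFinset Ω δ) criticalBetaTwo 0 .free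
    (spinMonomial fun i => nearestSite δ (a i))

/-- `𝔼^free_{Ω_δ}[σ_aσ_c]` is the free set-indexed correlation of `{[a/δ], [c/δ]}` when the two
rounded sites differ. [folklore] -/
theorem meshIsingFreeCorr_two_eq (Ω : Set ℂ) (δ : ℝ) {a c : ℂ} (h : nearestSite δ a ≠ nearestSite δ c) :
    meshIsingFreeCorr Ω δ ![a, c] =
      isingCorr (discreteDomainGraph Ω δ) (meshInteriorFinset Ω δ) criticalBetaTwo 0 .free
        {nearestSite δ a, nearestSite δ c} := by
  unfold meshIsingFreeCorr isingCorr
  congr 1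
  funext s
  simp [spinMonomial, spinProduct, Fin.prod_univ_two, Finset.prod_pair h]

/-- **FKG/GKS sandwich, lower half** (CHI §2.9: "`𝔼^free_{Λ_δ}[σ_aσ_b] ≤ 𝔼_{ℂ_δ}[σ_aσ_b] ≤ 𝔼⁺_{Ω_δ}[σ_aσ_b]`"):
on the same discrete domain, `𝔼^free_{Ω_δ}[σ_aσ_c] ≤ 𝔼⁺_{Ω_δ}[σ_aσ_c]` once both rounded sites are free
and distinct (the `+` couplings dominate, `isingCorr_le_isingCorr_plus`). [cite: ChelkakHonglerIzyurovAnnals2015, §2.9 (FKG comparison of boundary conditions)] -/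
theorem meshIsingFreeCorr_two_le_plus {Ω : Set ℂ} {δ : ℝ} {a c : ℂ}
    (ha : nearestSite δ a ∈ meshInteriorFinset Ω δ) (hc : nearestSite δ c ∈ meshInteriorFinset Ω δ)
    (h : nearestSite δ a ≠ nearestSite δ c) :
    meshIsingFreeCorr Ω δ ![a, c] ≤ meshIsingPlusCorr Ω δ ![a, c] := by
  rw [meshIsingPlusCorr_two_eq Ω δ h, meshIsingFreeCorr_two_eq Ω δ h]
  refine isingCorr_le_isingCorr_plus (discreteDomainGraph Ω δ) criticalBetaTwo_pos.le le_rfl .free ?_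
  intro z hz
  simp only [Finset.mem_insert, Finset.mem_singleton] at hz
  rcases hz with rfl | rfl
  · exact ha
  · exact hc

/-- **GKS I for the free correlations**: `0 ≤ 𝔼^free_{Ω_δ}[σ_aσ_c]` once both rounded sites are
free and distinct. [cite: FriedliVelenik2017, Thm. 3.20, eq. (3.21)] -/
theorem meshIsingFreeCorr_two_nonneg {Ω : Set ℂ} {δ : ℝ} {a c : ℂ}
    (ha : nearestSite δ a ∈ meshInteriorFinset Ω δ) (hc : nearestSite δ c ∈ meshInteriorFinset Ω δ)
    (h : nearestSite δ a ≠ nearestSite δ c) : 0 ≤ meshIsingFreeCorr Ω δ ![a, c] := by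
  rw [meshIsingFreeCorr_two_eq Ω δ h]
  refine GKSInequalities.gks_one_holds (discreteDomainGraph Ω δ) criticalBetaTwo_pos.le le_rfl
    (Or.inl rfl) ?_
  intro z hz
  simp only [Finset.mem_insert, Finset.mem_singleton] at hz
  rcases hz with rfl | rfl
  · exact ha
  · exact hc

/-- **The GHS application of CHI's proof of Lemma 2.26, for the CHI correlations**:
`𝔼⁺_{Ω_δ}[σ_aσ_c] - 𝔼⁺_{Ω_δ}[σ_a] 𝔼⁺_{Ω_δ}[σ_c] ≤ 𝔼^free_{Ω_δ}[σ_aσ_c]` once both rounded sites are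
free and distinct (`isingCorr_pair_trunc_plus_le_free` of `GHSTruncatedPair.lean`: GHS,
integrated along the boundary fields). [cite: ChelkakHonglerIzyurovAnnals2015, §2.10, proof of Lemma 2.26 (GHS application)] -/
theorem meshIsingPlusCorr_two_sub_mul_le_free {Ω : Set ℂ} {δ : ℝ} {a c : ℂ}
    (ha : nearestSite δ a ∈ meshInteriorFinset Ω δ) (hc : nearestSite δ c ∈ meshInteriorFinset Ω δ)
    (h : nearestSite δ a ≠ nearestSite δ c) :
    meshIsingPlusCorr Ω δ ![a, c] - meshIsingPlusCorr Ω δ ![a] * meshIsingPlusCorr Ω δ ![c] ≤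
      meshIsingFreeCorr Ω δ ![a, c] := by
  rw [meshIsingPlusCorr_two_eq Ω δ h, meshIsingPlusCorr_one_eq, meshIsingPlusCorr_one_eq,
    meshIsingFreeCorr_two_eq Ω δ h]
  exact isingCorr_pair_trunc_plus_le_free (discreteDomainGraph Ω δ) criticalBetaTwo_pos.le ha hc h

end Lattice

/-! ### Boundary approach through the uniformising map -/

/-- **Points with small `Im φ` are close to `∂Ω`**: for a bounded open `Ω`, a continuous
`φ : Ω → ℍ` and `ε > 0` there is `m > 0` such that every `c ∈ Ω` with `Im φ(c) < m` is within `ε`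
of `Ωᶜ` (the points of `Ω` at distance `≥ ε` from `Ωᶜ` form a compact set on which `Im φ` has a
positive minimum). [folklore] -/
theorem exists_im_lt_imp_infDist_lt {Ω : Set ℂ} (hΩo : IsOpen Ω) (hΩb : Bornology.IsBounded Ω)
    {φ : ℂ → ℂ} (hφc : ContinuousOn φ Ω) (hφm : MapsTo φ Ω UpperHalfPlane.upperHalfPlaneSet)
    {ε : ℝ} (hε : 0 < ε) :
    ∃ m : ℝ, 0 < m ∧ ∀ c ∈ Ω, (φ c).im < m → Metric.infDist c Ωᶜ < ε := by
  have _ := hΩo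
  set K : Set ℂ := {z | ε ≤ Metric.infDist z Ωᶜ} with hK
  have hKΩ : K ⊆ Ω := by
    intro z hz
    by_contra hzΩ
    have h0 : Metric.infDist z Ωᶜ = 0 := Metric.infDist_zero_of_mem hzΩ
    have hz' : ε ≤ Metric.infDist z Ωᶜ := hz
    rw [h0] at hz'
    exact absurd hz' (not_le.2 hε)
  have hKc : IsClosed K := isClosed_le continuous_const (Metric.continuous_infDist_pt _)
  have hKcpt : IsCompact K := Metric.isCompact_of_isClosed_isBounded hKc (hΩb.subset hKΩ)
  rcases Set.eq_empty_or_nonempty K with hKe | hKne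
  · refine ⟨1, one_pos, fun c _ _ => ?_⟩
    by_contra hcon
    have hcK : c ∈ K := not_lt.1 hcon
    rw [hKe] at hcK
    exact hcK
  · obtain ⟨z₀, hz₀K, hmin⟩ := hKcpt.exists_isMinOn hKne
      ((Complex.continuous_im.comp_continuousOn hφc).mono hKΩ)
    refine ⟨(φ z₀).im, hφm (hKΩ hz₀K), fun c _ hlt => ?_⟩
    by_contra hcon
    have hcK : c ∈ K := not_lt.1 hcon
    have hle : (φ z₀).im ≤ (φ c).im := (isMinOn_iff.1 hmin) c hcK
    exact absurd hlt (not_lt.2 hle)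

/-! ### CHI Theorem 1.3 for `k = 0` from Theorem 1.1, Proposition 2.20 and Lemma 2.26 -/

/-- **The core of CHI's derivation `T₁ & L₁ ⇒ T₀` (proof of Thm 1.3, §2.10, p. 20), at one
point, with the boundary decorrelation required only along the path actually used.** As
`tendsto_onePoint_rho_of_CHI` below, except that the third hypothesis asks for the lower bound of
CHI Lemma 2.26 (`k = 1`) only at the auxiliary points `c` with `φ(c) = Re φ(a) + it`, for all
small `t > 0`: `hL` — for every `η > 0`, eventually as `t → 0⁺`, every `c ∈ Ω` with
`φ(c) = Re φ(a) + it` satisfies `(1 - η) 𝔼⁺_{Ω_δ}[σ_cσ_a] ≤ 𝔼⁺_{Ω_δ}[σ_c] 𝔼⁺_{Ω_δ}[σ_a]` for all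
small `δ`. The printed form of Lemma 2.26 feeds this statement (`tendsto_onePoint_rho_of_CHI`);
the route from CHI Thm 1.1 alone (`tendsto_onePoint_rho_of_twoPoint`) uses two auxiliary points
instead. [cite: ChelkakHonglerIzyurovAnnals2015, §2.10, proof of Thm. 1.3 (case k = 0)] -/
theorem tendsto_onePoint_rho_core {Ω : Set ℂ} (hΩ : IsAdmissibleDomain Ω) (hM : MeshApproximates Ω)
    {φ : ℂ → ℂ} (hφ : IsConformalBijection φ Ω UpperHalfPlane.upperHalfPlaneSet) {a : ℂ} (ha : a ∈ Ω)
    (hT : ∀ c ∈ Ω, c ≠ a →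
      Tendsto (fun δ => meshIsingPlusCorr Ω δ ![a, c] / rhoCHI δ) (𝓝[>] 0)
        (𝓝 (twoPointPlusCHI φ a c)))
    (hP : ∀ c ∈ Ω,
      Tendsto (fun δ => meshIsingPlusCorr Ω δ ![a] / meshIsingPlusCorr Ω δ ![c]) (𝓝[>] 0)
        (𝓝 (onePointPlusCHI φ a / onePointPlusCHI φ c)))
    (hL : ∀ η : ℝ, 0 < η → ∀ᶠ t : ℝ in 𝓝[>] (0 : ℝ), ∀ c ∈ Ω,
      φ c = (φ a).re + (t : ℂ) * Complex.I →
        ∀ᶠ δ in 𝓝[>] (0 : ℝ), (1 - η) * meshIsingPlusCorr Ω δ ![c, a] ≤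
          meshIsingPlusCorr Ω δ ![c] * meshIsingPlusCorr Ω δ ![a]) :
    Tendsto (fun δ => rhoCHI δ ^ (-(1 : ℝ) / 2) * meshIsingPlusCorr Ω δ ![a]) (𝓝[>] 0)
      (𝓝 (onePointPlusCHI φ a)) := by
  have hφa : 0 < (φ a).im := hφ.2.mapsTo ha
  have hda : deriv φ a ≠ 0 :=
    Literature.Analysis.Complex.SCV.deriv_ne_zero_of_injOn hφ.1 hΩ.1 hφ.2.injOn ha
  have hLpos : 0 < onePointPlusCHI φ a := onePointPlusCHI_pos hda hφa
  -- GKS I at `a`, eventually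
  have hAnn : ∀ᶠ δ in 𝓝[>] (0 : ℝ), 0 ≤ meshIsingPlusCorr Ω δ ![a] := eventually_onePoint_nonneg hM ha
  -- Step 1: `ϱ⁻¹ 𝔼[σ_a]² → ⟨σ_a⟩²`
  have hQ : Tendsto (fun δ => (rhoCHI δ)⁻¹ * meshIsingPlusCorr Ω δ ![a] ^ 2) (𝓝[>] 0)
      (𝓝 (onePointPlusCHI φ a ^ 2)) := by
    refine tendsto_of_ratio_squeeze (sq_nonneg _) fun η hη _ => ?_
    -- the auxiliary point `c = φ⁻¹ (Re φ a + i t)`, `t` small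
    obtain ⟨t, ht0, hta, hRt, hLt⟩ : ∃ t : ℝ, 0 < t ∧ t < (φ a).im ∧
        ratioCHI (φ a) ((φ a).re + t * Complex.I) < 1 + η ∧
        ∀ c ∈ Ω, φ c = (φ a).re + (t : ℂ) * Complex.I →
          ∀ᶠ δ in 𝓝[>] (0 : ℝ), (1 - η) * meshIsingPlusCorr Ω δ ![c, a] ≤
            meshIsingPlusCorr Ω δ ![c] * meshIsingPlusCorr Ω δ ![a] := by
      have h2 : ∀ᶠ t in 𝓝[>] (0 : ℝ), t < (φ a).im :=
        mem_nhdsWithin_of_mem_nhds (Iio_mem_nhds hφa)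
      have h3 : ∀ᶠ t : ℝ in 𝓝[>] (0 : ℝ), ratioCHI (φ a) ((φ a).re + (t : ℂ) * Complex.I) < 1 + η :=
        (tendsto_ratioCHI_vertical hφa).eventually_lt_const (by linarith)
      have h4 := hL η hη
      have h0 : ∀ᶠ t in 𝓝[>] (0 : ℝ), 0 < t := self_mem_nhdsWithin
      obtain ⟨t, ht⟩ := (((h0.and h2).and h3).and h4).exists
      exact ⟨t, ht.1.1.1, ht.1.1.2, ht.1.2, ht.2⟩
    set w : ℂ := (φ a).re + t * Complex.I with hw
    have hwim : w.im = t := by simp [hw]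
    have hwH : w ∈ UpperHalfPlane.upperHalfPlaneSet := by
      show 0 < w.im
      rw [hwim]; exact ht0
    obtain ⟨c, hc, hcw⟩ := hφ.2.surjOn hwH
    have hca : c ≠ a := by
      rintro rfl
      have : (φ c).im = t := by rw [hcw, hwim]
      linarith
    have hφc : 0 < (φ c).im := hφ.2.mapsTo hc
    have hdc : deriv φ c ≠ 0 :=
      Literature.Analysis.Complex.SCV.deriv_ne_zero_of_injOn hφ.1 hΩ.1 hφ.2.injOn hc
    have hLc : 0 < onePointPlusCHI φ c := onePointPlusCHI_pos hdc hφc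
    have hLc0 : onePointPlusCHI φ c ≠ 0 := hLc.ne'
    have hLδ' := hLt c hc hcw
    have hw1 : w ≠ φ a := fun h => by
      have := congrArg Complex.im h
      rw [hwim] at this
      linarith
    have hw2 : w ≠ (starRingEnd ℂ) (φ a) := fun h => by
      have := congrArg Complex.im h
      rw [hwim, Complex.conj_im] at this
      linarith
    refine ⟨fun δ => meshIsingPlusCorr Ω δ ![a, c] / rhoCHI δ *
        (meshIsingPlusCorr Ω δ ![a] / meshIsingPlusCorr Ω δ ![c]),
      ratioCHI (φ a) w, one_le_ratioCHI hw1 hw2, hRt.le, ?_, ?_⟩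
    · -- the limit of the comparison quantity (Thm 1.1 × Prop 2.20)
      have h := (hT c hc hca).mul (hP c hc)
      rw [twoPointPlusCHI_eq_mul_ratioCHI hφa hφc, hcw] at h
      convert h using 2
      field_simp
    · -- the eventual two-sided bound (Lemma 2.26 and GKS)
      have hGpos : ∀ᶠ δ in 𝓝[>] (0 : ℝ),
          0 < meshIsingPlusCorr Ω δ ![a] / meshIsingPlusCorr Ω δ ![c] :=
        (hP c hc).eventually_const_lt (div_pos hLpos hLc)
      filter_upwards [hGpos, hAnn, hLδ', eventually_nearestSite_mem_meshInteriorFinset hM ha,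
        eventually_nearestSite_mem_meshInteriorFinset hM hc, eventually_nearestSite_ne hca.symm]
        with δ hG hA hLδ hxa hxc hne
      have hgks2 := meshIsingPlusCorr_mul_le_two hxa hxc hne
      rw [meshIsingPlusCorr_two_symm Ω δ a c] at hLδ
      have hA0 : meshIsingPlusCorr Ω δ ![a] ≠ 0 := fun h => by
        rw [h, zero_div] at hG
        exact lt_irrefl 0 hG
      have hCpos : 0 < meshIsingPlusCorr Ω δ ![c] :=
        ((div_pos_iff.1 hG).resolve_right fun h' => absurd h'.1 (not_lt.2 hA)).2
      have hρ : 0 ≤ (rhoCHI δ)⁻¹ := inv_nonneg.2 (rhoCHI_nonneg δ)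
      have hQeq : (rhoCHI δ)⁻¹ * meshIsingPlusCorr Ω δ ![a] ^ 2 =
          (rhoCHI δ)⁻¹ * (meshIsingPlusCorr Ω δ ![a] * meshIsingPlusCorr Ω δ ![c]) *
            (meshIsingPlusCorr Ω δ ![a] / meshIsingPlusCorr Ω δ ![c]) := by
        field_simp
      have hBeq : meshIsingPlusCorr Ω δ ![a, c] / rhoCHI δ *
          (meshIsingPlusCorr Ω δ ![a] / meshIsingPlusCorr Ω δ ![c]) =
          (rhoCHI δ)⁻¹ * meshIsingPlusCorr Ω δ ![a, c] *
            (meshIsingPlusCorr Ω δ ![a] / meshIsingPlusCorr Ω δ ![c]) := by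
        ring
      rw [hQeq, hBeq]
      constructor
      · have h1 : (1 - η) * meshIsingPlusCorr Ω δ ![a, c] ≤
            meshIsingPlusCorr Ω δ ![a] * meshIsingPlusCorr Ω δ ![c] := by
          rw [mul_comm (meshIsingPlusCorr Ω δ ![a])]; exact hLδ
        calc (1 - η) * ((rhoCHI δ)⁻¹ * meshIsingPlusCorr Ω δ ![a, c] *
              (meshIsingPlusCorr Ω δ ![a] / meshIsingPlusCorr Ω δ ![c]))
            = (rhoCHI δ)⁻¹ * ((1 - η) * meshIsingPlusCorr Ω δ ![a, c]) *
              (meshIsingPlusCorr Ω δ ![a] / meshIsingPlusCorr Ω δ ![c]) := by ring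
          _ ≤ (rhoCHI δ)⁻¹ * (meshIsingPlusCorr Ω δ ![a] * meshIsingPlusCorr Ω δ ![c]) *
              (meshIsingPlusCorr Ω δ ![a] / meshIsingPlusCorr Ω δ ![c]) :=
            mul_le_mul_of_nonneg_right (mul_le_mul_of_nonneg_left h1 hρ) hG.le
      · exact mul_le_mul_of_nonneg_right (mul_le_mul_of_nonneg_left hgks2 hρ) hG.le
  -- Step 2: take square roots (`𝔼[σ_a] ≥ 0`, `ϱ ≥ 0`)
  have hsqrt : Tendsto (fun δ => Real.sqrt ((rhoCHI δ)⁻¹ * meshIsingPlusCorr Ω δ ![a] ^ 2))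
      (𝓝[>] 0) (𝓝 (onePointPlusCHI φ a)) := by
    have := hQ.sqrt
    rwa [Real.sqrt_sq hLpos.le] at this
  refine hsqrt.congr' ?_
  filter_upwards [hAnn] with δ hA
  have hρ := rhoCHI_nonneg δ
  rw [Real.sqrt_mul (inv_nonneg.2 hρ), Real.sqrt_sq hA, Real.sqrt_inv, Real.sqrt_eq_rpow,
    ← Real.rpow_neg hρ]
  congr 1
  norm_num

/-- **CHI's derivation `T₁ & L₁ ⇒ T₀` (proof of Thm 1.3, §2.10, p. 20 of arXiv:1202.2838), at
one point.** Let `Ω` be admissible with `MeshApproximates Ω`, `φ : Ω → ℍ` a conformal bijection and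
`a ∈ Ω`. Assume, for this `Ω`, `φ`, `a`:
* `hT` — **CHI Thm 1.1** (`+` case, with (1.2)–(1.3)): for every `c ∈ Ω`, `c ≠ a`,
  `𝔼⁺_{Ω_δ}[σ_aσ_c] / ϱ(δ) → ⟨σ_aσ_c⟩⁺_Ω = twoPointPlusCHI φ a c`;
* `hP` — **CHI Prop 2.20** (`k = 0`; the continuum one-point function being (1.3) transported by
  (1.2), CHI §2.8/Lemma 2.22): for every `c ∈ Ω`,
  `𝔼⁺_{Ω_δ}[σ_a] / 𝔼⁺_{Ω_δ}[σ_c] → ⟨σ_a⟩⁺_Ω / ⟨σ_c⟩⁺_Ω`;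
* `hL` — **CHI Lemma 2.26** (`k = 1`, lower bound; the upper bound is GKS II,
  `meshIsingPlusCorr_mul_le_two`): for every `η > 0` there is `ε > 0` such that for every `c ∈ Ω`
  within `ε` of `∂Ω`, `(1 - η) 𝔼⁺_{Ω_δ}[σ_cσ_a] ≤ 𝔼⁺_{Ω_δ}[σ_c] 𝔼⁺_{Ω_δ}[σ_a]` for all small `δ`.
Then `ϱ(δ)^{-1/2} 𝔼⁺_{Ω_δ}[σ_a] → ⟨σ_a⟩⁺_Ω = 2^{1/4} |φ'(a)|^{1/8} (2 Im φ(a))^{-1/8}`.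
Proof as printed: write `(𝔼[σ_a]/√ϱ)² = (𝔼[σ_a]𝔼[σ_c]/𝔼[σ_aσ_c]) · (𝔼[σ_aσ_c]/ϱ) · (𝔼[σ_a]/𝔼[σ_c])`
with `c = φ⁻¹(Re φ(a) + it)` close to `∂Ω`; the first factor is pinched in `[1 - η, 1]`, the other
two converge, `⟨σ_aσ_c⟩⁺_Ω / (⟨σ_a⟩⁺_Ω⟨σ_c⟩⁺_Ω) = √((u + u⁻¹)/2) → 1` as `t → 0`, and positivity of
the magnetisation (GKS I) fixes the sign of the square root.
[cite: ChelkakHonglerIzyurovAnnals2015, §2.10, proof of Thm. 1.3 (case k = 0)] -/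
theorem tendsto_onePoint_rho_of_CHI {Ω : Set ℂ} (hΩ : IsAdmissibleDomain Ω) (hM : MeshApproximates Ω)
    {φ : ℂ → ℂ} (hφ : IsConformalBijection φ Ω UpperHalfPlane.upperHalfPlaneSet) {a : ℂ} (ha : a ∈ Ω)
    (hT : ∀ c ∈ Ω, c ≠ a →
      Tendsto (fun δ => meshIsingPlusCorr Ω δ ![a, c] / rhoCHI δ) (𝓝[>] 0)
        (𝓝 (twoPointPlusCHI φ a c)))
    (hP : ∀ c ∈ Ω,
      Tendsto (fun δ => meshIsingPlusCorr Ω δ ![a] / meshIsingPlusCorr Ω δ ![c]) (𝓝[>] 0)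
        (𝓝 (onePointPlusCHI φ a / onePointPlusCHI φ c)))
    (hL : ∀ η : ℝ, 0 < η → ∃ ε : ℝ, 0 < ε ∧ ∀ c ∈ Ω, Metric.infDist c Ωᶜ < ε →
      ∀ᶠ δ in 𝓝[>] (0 : ℝ), (1 - η) * meshIsingPlusCorr Ω δ ![c, a] ≤
        meshIsingPlusCorr Ω δ ![c] * meshIsingPlusCorr Ω δ ![a]) :
    Tendsto (fun δ => rhoCHI δ ^ (-(1 : ℝ) / 2) * meshIsingPlusCorr Ω δ ![a]) (𝓝[>] 0)
      (𝓝 (onePointPlusCHI φ a)) := by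
  refine tendsto_onePoint_rho_core hΩ hM hφ ha hT hP fun η hη => ?_
  obtain ⟨ε, hε, hLε⟩ := hL η hη
  obtain ⟨m, hm, hbdry⟩ :=
    exists_im_lt_imp_infDist_lt hΩ.1 hΩ.2.1 hφ.1.continuousOn hφ.2.mapsTo hε
  have h1 : ∀ᶠ t : ℝ in 𝓝[>] (0 : ℝ), t < m := mem_nhdsWithin_of_mem_nhds (Iio_mem_nhds hm)
  filter_upwards [h1] with t ht c hc hcw
  refine hLε c hc (hbdry c hc ?_)
  rw [hcw]
  simpa using ht

/-! ### CHI Theorem 1.3 (`k = 0`) from CHI Theorem 1.1 alone (both boundary conditions) -/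

/-- **Boundary decorrelation from CHI Thm 1.1 (both boundary conditions) and GHS** (CHI, proof
of Lemma 2.26, `k = 1`): for distinct `x, y ∈ Ω` with `𝓑_ℍ(φx; φy) < η`, eventually
`(1 - η) 𝔼⁺_{Ω_δ}[σ_xσ_y] ≤ 𝔼⁺_{Ω_δ}[σ_x] 𝔼⁺_{Ω_δ}[σ_y]`, and `𝔼⁺_{Ω_δ}[σ_xσ_y] > 0`, `ϱ(δ) > 0`:
indeed `𝔼⁺[σ_xσ_y] - 𝔼⁺[σ_x]𝔼⁺[σ_y] ≤ 𝔼^free[σ_xσ_y]` (GHS, `meshIsingPlusCorr_two_sub_mul_le_free`)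
and `𝔼^free[σ_xσ_y]/𝔼⁺[σ_xσ_y] → ⟨σ_xσ_y⟩^free_Ω/⟨σ_xσ_y⟩⁺_Ω = 𝓑 < η` (Thm 1.1 twice).
[cite: ChelkakHonglerIzyurovAnnals2015, §2.10, proof of Lemma 2.26 (k = 1)] -/
theorem eventually_decorr_of_bCHI_lt {Ω : Set ℂ} (hΩ : IsAdmissibleDomain Ω)
    (hM : MeshApproximates Ω) {φ : ℂ → ℂ}
    (hφ : IsConformalBijection φ Ω UpperHalfPlane.upperHalfPlaneSet) {x y : ℂ} (hx : x ∈ Ω)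
    (hy : y ∈ Ω) (hxy : x ≠ y)
    (hT : Tendsto (fun δ => meshIsingPlusCorr Ω δ ![x, y] / rhoCHI δ) (𝓝[>] 0)
      (𝓝 (twoPointPlusCHI φ x y)))
    (hTf : Tendsto (fun δ => meshIsingFreeCorr Ω δ ![x, y] / rhoCHI δ) (𝓝[>] 0)
      (𝓝 (twoPointFreeCHI φ x y)))
    {η : ℝ} (hB : bCHI (φ x) (φ y) < η) :
    ∀ᶠ δ in 𝓝[>] (0 : ℝ),
      (1 - η) * meshIsingPlusCorr Ω δ ![x, y] ≤ meshIsingPlusCorr Ω δ ![x] * meshIsingPlusCorr Ω δ ![y] ∧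
        0 < meshIsingPlusCorr Ω δ ![x, y] ∧ 0 < rhoCHI δ := by
  have hφx : 0 < (φ x).im := hφ.2.mapsTo hx
  have hφy : 0 < (φ y).im := hφ.2.mapsTo hy
  have hw1 : φ y ≠ φ x := fun h => hxy (hφ.2.injOn hx hy h.symm)
  have hw2 : φ y ≠ (starRingEnd ℂ) (φ x) := fun h => by
    have h' := congrArg Complex.im h
    rw [Complex.conj_im] at h'
    linarith
  have hdx : deriv φ x ≠ 0 :=
    Literature.Analysis.Complex.SCV.deriv_ne_zero_of_injOn hφ.1 hΩ.1 hφ.2.injOn hx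
  have hdy : deriv φ y ≠ 0 :=
    Literature.Analysis.Complex.SCV.deriv_ne_zero_of_injOn hφ.1 hΩ.1 hφ.2.injOn hy
  have hLx : 0 < onePointPlusCHI φ x := onePointPlusCHI_pos hdx hφx
  have hLy : 0 < onePointPlusCHI φ y := onePointPlusCHI_pos hdy hφy
  have hPlus : 0 < twoPointPlusCHI φ x y := by
    rw [twoPointPlusCHI_eq_mul_ratioCHI hφx hφy]
    exact mul_pos (mul_pos hLx hLy) (lt_of_lt_of_le one_pos (one_le_ratioCHI hw1 hw2))
  have hpos : ∀ᶠ δ in 𝓝[>] (0 : ℝ), 0 < meshIsingPlusCorr Ω δ ![x, y] / rhoCHI δ :=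
    hT.eventually_const_lt hPlus
  have hratio : Tendsto (fun δ => meshIsingFreeCorr Ω δ ![x, y] / meshIsingPlusCorr Ω δ ![x, y])
      (𝓝[>] 0) (𝓝 (bCHI (φ x) (φ y))) := by
    have h := hTf.div hT hPlus.ne'
    rw [twoPointFreeCHI_eq_mul_bCHI hw1 hw2, mul_div_cancel_left₀ _ hPlus.ne'] at h
    refine h.congr' ?_
    filter_upwards [hpos] with δ hδ
    have hρ : rhoCHI δ ≠ 0 := by
      intro h0
      rw [h0, div_zero] at hδ
      exact lt_irrefl 0 hδ
    simp only [Pi.div_apply]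
    rw [div_div_div_cancel_right₀ hρ]
  filter_upwards [hratio.eventually_lt_const hB, hpos,
    eventually_nearestSite_mem_meshInteriorFinset hM hx,
    eventually_nearestSite_mem_meshInteriorFinset hM hy, eventually_nearestSite_ne hxy]
    with δ hr hp hsx hsy hne
  have hρpos : 0 < rhoCHI δ := by
    rcases div_pos_iff.1 hp with h | h
    · exact h.2
    · exact absurd h.2 (not_lt.2 (rhoCHI_nonneg δ))
  have hP2 : 0 < meshIsingPlusCorr Ω δ ![x, y] := by
    rcases div_pos_iff.1 hp with h | h
    · exact h.1
    · exact absurd h.2 (not_lt.2 (rhoCHI_nonneg δ))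
  have hghs := meshIsingPlusCorr_two_sub_mul_le_free hsx hsy hne
  have hfree : meshIsingFreeCorr Ω δ ![x, y] < η * meshIsingPlusCorr Ω δ ![x, y] := by
    rwa [div_lt_iff₀ hP2] at hr
  exact ⟨by linarith, hP2, hρpos⟩

/-- **CHI Theorem 1.3 (`k = 0`) at one point, from CHI Theorem 1.1 alone (both boundary
conditions).** Let `Ω` be admissible with `MeshApproximates Ω`, `φ : Ω → ℍ` a conformal bijection
and `a ∈ Ω`. Assume, for this `Ω`, `φ` and all distinct `x, y ∈ Ω`:
* `hT` — **CHI Thm 1.1, `+` case** (limit (1.2)–(1.3)): `𝔼⁺_{Ω_δ}[σ_xσ_y] / ϱ(δ) → ⟨σ_xσ_y⟩⁺_Ω`;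
* `hTf` — **CHI Thm 1.1, free case** (limit (1.2)–(1.3)), for the free model on the same discrete
  domains (`meshIsingFreeCorr`): `𝔼^free_{Ω_δ}[σ_xσ_y] / ϱ(δ) → ⟨σ_xσ_y⟩^free_Ω`.
Then `ϱ(δ)^{-1/2} 𝔼⁺_{Ω_δ}[σ_a] → ⟨σ_a⟩⁺_Ω = 2^{1/4} |φ'(a)|^{1/8} (2 Im φ(a))^{-1/8}`.
Proof: a variant of CHI's argument (§2.10, p. 20) with TWO auxiliary points `d = φ⁻¹(Re φa + it)`,
`d' = φ⁻¹(Re φa + 1 + it)` near `∂Ω`, which dispenses with Prop 2.20: by GKS II and the boundary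
decorrelation (`eventually_decorr_of_bCHI_lt`, i.e. GHS + Thm 1.1) at the three pairs,
`𝔼[σ_a]² = (𝔼[σ_a]𝔼[σ_d])(𝔼[σ_a]𝔼[σ_{d'}])/(𝔼[σ_d]𝔼[σ_{d'}])` is pinched between
`(1-η)² 𝔼[σ_aσ_d]𝔼[σ_aσ_{d'}]/𝔼[σ_dσ_{d'}]` and `𝔼[σ_aσ_d]𝔼[σ_aσ_{d'}]/((1-η)𝔼[σ_dσ_{d'}])`; dividing
by `ϱ`, Thm 1.1 (`+`) thrice gives the limit `⟨σ_aσ_d⟩⟨σ_aσ_{d'}⟩/⟨σ_dσ_{d'}⟩ = ⟨σ_a⟩² · R₁R₂/R₃` with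
`Rᵢ = √((uᵢ + uᵢ⁻¹)/2) → 1` as `t → 0` (all three `uᵢ → 1`), whence `ϱ⁻¹𝔼[σ_a]² → ⟨σ_a⟩²`
(`tendsto_of_ratio_squeeze`), and GKS I fixes the sign of the square root.
[cite: ChelkakHonglerIzyurovAnnals2015, §2.10, proofs of Lemma 2.26 and Thm. 1.3 (k = 0); Thm. 1.1] -/
theorem tendsto_onePoint_rho_of_twoPoint {Ω : Set ℂ} (hΩ : IsAdmissibleDomain Ω)
    (hM : MeshApproximates Ω) {φ : ℂ → ℂ}
    (hφ : IsConformalBijection φ Ω UpperHalfPlane.upperHalfPlaneSet) {a : ℂ} (ha : a ∈ Ω)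
    (hT : ∀ x ∈ Ω, ∀ y ∈ Ω, x ≠ y →
      Tendsto (fun δ => meshIsingPlusCorr Ω δ ![x, y] / rhoCHI δ) (𝓝[>] 0)
        (𝓝 (twoPointPlusCHI φ x y)))
    (hTf : ∀ x ∈ Ω, ∀ y ∈ Ω, x ≠ y →
      Tendsto (fun δ => meshIsingFreeCorr Ω δ ![x, y] / rhoCHI δ) (𝓝[>] 0)
        (𝓝 (twoPointFreeCHI φ x y))) :
    Tendsto (fun δ => rhoCHI δ ^ (-(1 : ℝ) / 2) * meshIsingPlusCorr Ω δ ![a]) (𝓝[>] 0)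
      (𝓝 (onePointPlusCHI φ a)) := by
  have hφa : 0 < (φ a).im := hφ.2.mapsTo ha
  have hda : deriv φ a ≠ 0 :=
    Literature.Analysis.Complex.SCV.deriv_ne_zero_of_injOn hφ.1 hΩ.1 hφ.2.injOn ha
  have hLa : 0 < onePointPlusCHI φ a := onePointPlusCHI_pos hda hφa
  have hAnn : ∀ᶠ δ in 𝓝[>] (0 : ℝ), 0 ≤ meshIsingPlusCorr Ω δ ![a] := eventually_onePoint_nonneg hM ha
  -- the two auxiliary boundary paths `w t = Re φa + it`, `w' t = Re φa + 1 + it`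
  set w : ℝ → ℂ := fun t => ((φ a).re : ℂ) + (t : ℂ) * Complex.I with hw
  set w' : ℝ → ℂ := fun t => ((φ a).re : ℂ) + 1 + (t : ℂ) * Complex.I with hw'
  have hwim : ∀ t, (w t).im = t := fun t => by simp [hw]
  have hw'im : ∀ t, (w' t).im = t := fun t => by simp [hw']
  have hwre : ∀ t, (w t).re = (φ a).re := fun t => by simp [hw]
  have hw're : ∀ t, (w' t).re = (φ a).re + 1 := fun t => by simp [hw']
  have hw0 : Tendsto w (𝓝 0) (𝓝 ((φ a).re : ℂ)) := by
    have hc : Continuous w := by simp only [hw]; fun_prop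
    have h := hc.tendsto 0
    have h0 : w 0 = ((φ a).re : ℂ) := by simp [hw]
    rwa [h0] at h
  have hw'0 : Tendsto w' (𝓝 0) (𝓝 (((φ a).re : ℂ) + 1)) := by
    have hc : Continuous w' := by simp only [hw']; fun_prop
    have h := hc.tendsto 0
    have h0 : w' 0 = ((φ a).re : ℂ) + 1 := by simp [hw']
    rwa [h0] at h
  -- `u → 1` for the three pairs, hence `R → 1` and `𝓑 → 0`
  have hq1 : ((φ a).re : ℂ) ≠ (starRingEnd ℂ) (φ a) := fun h => by
    have h' := congrArg Complex.im h
    simp at h'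
    exact hφa.ne' (by linarith)
  have hq2 : ((φ a).re : ℂ) + 1 ≠ (starRingEnd ℂ) (φ a) := fun h => by
    have h' := congrArg Complex.im h
    simp at h'
    exact hφa.ne' (by linarith)
  have hq3 : ((φ a).re : ℂ) + 1 ≠ (starRingEnd ℂ) ((φ a).re : ℂ) := fun h => by
    have h' := congrArg Complex.re h
    simp at h'
  have hu1 : Tendsto (fun t => uCHI (φ a) (w t)) (𝓝 0) (𝓝 1) := by
    have h := tendsto_uCHI tendsto_const_nhds hw0 hq1
    rwa [uCHI_self_re hφa.ne'] at h
  have hu2 : Tendsto (fun t => uCHI (φ a) (w' t)) (𝓝 0) (𝓝 1) := by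
    have h := tendsto_uCHI tendsto_const_nhds hw'0 hq2
    rwa [uCHI_self_re_add_one] at h
  have hu3 : Tendsto (fun t => uCHI (w t) (w' t)) (𝓝 0) (𝓝 1) := by
    have h := tendsto_uCHI hw0 hw'0 hq3
    rwa [uCHI_re_re_add_one] at h
  have hρ : Tendsto (fun t => ratioCHI (φ a) (w t) * ratioCHI (φ a) (w' t) / ratioCHI (w t) (w' t))
      (𝓝 0) (𝓝 1) := by
    have h := ((tendsto_ratioCHI_of_uCHI hu1).mul (tendsto_ratioCHI_of_uCHI hu2)).div
      (tendsto_ratioCHI_of_uCHI hu3) one_ne_zero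
    rw [mul_one, div_one] at h
    exact h
  have hb1 := tendsto_bCHI_of_uCHI hu1
  have hb2 := tendsto_bCHI_of_uCHI hu2
  have hb3 := tendsto_bCHI_of_uCHI hu3
  -- Step 1: `ϱ⁻¹ 𝔼[σ_a]² → ⟨σ_a⟩²`
  have hQ : Tendsto (fun δ => (rhoCHI δ)⁻¹ * meshIsingPlusCorr Ω δ ![a] ^ 2) (𝓝[>] 0)
      (𝓝 (onePointPlusCHI φ a ^ 2)) := by
    refine tendsto_of_ratio_squeeze (sq_nonneg _) fun η₀ hη₀ hη₀' => ?_
    set η : ℝ := η₀ / 4 with hηdef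
    have hη0 : 0 < η := by rw [hηdef]; positivity
    have hη1 : η ≤ 1 / 8 := by rw [hηdef]; linarith
    have h1η : 0 < 1 - η := by linarith
    -- choose `t`
    obtain ⟨t, ht0, hta, hρt, hb1t, hb2t, hb3t⟩ : ∃ t : ℝ, 0 < t ∧ t < (φ a).im ∧
        ratioCHI (φ a) (w t) * ratioCHI (φ a) (w' t) / ratioCHI (w t) (w' t) ∈
          Set.Icc (1 - η) (1 + 2 * η) ∧
        bCHI (φ a) (w t) < η ∧ bCHI (φ a) (w' t) < η ∧ bCHI (w t) (w' t) < η := by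
      have e0 : ∀ᶠ t in 𝓝[>] (0 : ℝ), 0 < t := self_mem_nhdsWithin
      have e1 : ∀ᶠ t in 𝓝[>] (0 : ℝ), t < (φ a).im :=
        mem_nhdsWithin_of_mem_nhds (Iio_mem_nhds hφa)
      have e2 : ∀ᶠ t in 𝓝[>] (0 : ℝ),
          ratioCHI (φ a) (w t) * ratioCHI (φ a) (w' t) / ratioCHI (w t) (w' t) ∈
            Set.Icc (1 - η) (1 + 2 * η) :=
        mem_nhdsWithin_of_mem_nhds (hρ (Icc_mem_nhds (by linarith) (by linarith)))
      have e3 : ∀ᶠ t in 𝓝[>] (0 : ℝ), bCHI (φ a) (w t) < η :=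
        mem_nhdsWithin_of_mem_nhds (hb1.eventually_lt_const hη0)
      have e4 : ∀ᶠ t in 𝓝[>] (0 : ℝ), bCHI (φ a) (w' t) < η :=
        mem_nhdsWithin_of_mem_nhds (hb2.eventually_lt_const hη0)
      have e5 : ∀ᶠ t in 𝓝[>] (0 : ℝ), bCHI (w t) (w' t) < η :=
        mem_nhdsWithin_of_mem_nhds (hb3.eventually_lt_const hη0)
      obtain ⟨t, ht⟩ := (((((e0.and e1).and e2).and e3).and e4).and e5).exists
      exact ⟨t, ht.1.1.1.1.1, ht.1.1.1.1.2, ht.1.1.1.2, ht.1.1.2, ht.1.2, ht.2⟩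
    -- the auxiliary points `d`, `d'`
    have hwH : w t ∈ UpperHalfPlane.upperHalfPlaneSet := by
      show 0 < (w t).im
      rw [hwim]; exact ht0
    have hw'H : w' t ∈ UpperHalfPlane.upperHalfPlaneSet := by
      show 0 < (w' t).im
      rw [hw'im]; exact ht0
    obtain ⟨d, hd, hdw⟩ := hφ.2.surjOn hwH
    obtain ⟨d', hd', hd'w⟩ := hφ.2.surjOn hw'H
    have had : a ≠ d := by
      intro h
      have h' := congrArg (fun z => (φ z).im) h
      simp only [hdw, hwim] at h'
      linarith
    have had' : a ≠ d' := by
      intro h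
      have h' := congrArg (fun z => (φ z).re) h
      simp only [hd'w, hw're] at h'
      linarith
    have hdd' : d ≠ d' := by
      intro h
      have h' := congrArg (fun z => (φ z).re) h
      simp only [hdw, hd'w, hwre, hw're] at h'
      linarith
    have hφd : 0 < (φ d).im := hφ.2.mapsTo hd
    have hφd' : 0 < (φ d').im := hφ.2.mapsTo hd'
    have hdd : deriv φ d ≠ 0 :=
      Literature.Analysis.Complex.SCV.deriv_ne_zero_of_injOn hφ.1 hΩ.1 hφ.2.injOn hd
    have hdd'' : deriv φ d' ≠ 0 :=
      Literature.Analysis.Complex.SCV.deriv_ne_zero_of_injOn hφ.1 hΩ.1 hφ.2.injOn hd'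
    have hLd : 0 < onePointPlusCHI φ d := onePointPlusCHI_pos hdd hφd
    have hLd' : 0 < onePointPlusCHI φ d' := onePointPlusCHI_pos hdd'' hφd'
    -- the three ratios `R₁, R₂, R₃ ≥ 1`
    have hv1 : φ d ≠ φ a := fun h => had (hφ.2.injOn ha hd h.symm)
    have hv1' : φ d ≠ (starRingEnd ℂ) (φ a) := fun h => by
      have h' := congrArg Complex.im h; rw [Complex.conj_im] at h'; linarith
    have hv2 : φ d' ≠ φ a := fun h => had' (hφ.2.injOn ha hd' h.symm)
    have hv2' : φ d' ≠ (starRingEnd ℂ) (φ a) := fun h => by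
      have h' := congrArg Complex.im h; rw [Complex.conj_im] at h'; linarith
    have hv3 : φ d' ≠ φ d := fun h => hdd' (hφ.2.injOn hd hd' h.symm)
    have hv3' : φ d' ≠ (starRingEnd ℂ) (φ d) := fun h => by
      have h' := congrArg Complex.im h; rw [Complex.conj_im] at h'; linarith
    have hR1 := one_le_ratioCHI hv1 hv1'
    have hR2 := one_le_ratioCHI hv2 hv2'
    have hR3 := one_le_ratioCHI hv3 hv3'
    have hR3pos : 0 < ratioCHI (φ d) (φ d') := lt_of_lt_of_le one_pos hR3
    -- limits of the three two-point functions (Thm 1.1, `+`)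
    have hT1 := hT a ha d hd had
    have hT2 := hT a ha d' hd' had'
    have hT3 := hT d hd d' hd' hdd'
    have hτ3 : 0 < twoPointPlusCHI φ d d' := by
      rw [twoPointPlusCHI_eq_mul_ratioCHI hφd hφd']
      exact mul_pos (mul_pos hLd hLd') hR3pos
    -- the three boundary decorrelations (GHS + Thm 1.1 free)
    have hdec1 := eventually_decorr_of_bCHI_lt hΩ hM hφ ha hd had hT1 (hTf a ha d hd had)
      (by rw [hdw]; exact hb1t)
    have hdec2 := eventually_decorr_of_bCHI_lt hΩ hM hφ ha hd' had' hT2 (hTf a ha d' hd' had')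
      (by rw [hd'w]; exact hb2t)
    have hdec3 := eventually_decorr_of_bCHI_lt hΩ hM hφ hd hd' hdd' hT3 (hTf d hd d' hd' hdd')
      (by rw [hdw, hd'w]; exact hb3t)
    -- `ρ = R₁ R₂ / R₃ ∈ [1 - η, 1 + 2η]`
    rw [hdw.symm, hd'w.symm] at hρt
    obtain ⟨hρlo, hρhi⟩ := hρt
    refine ⟨fun δ => meshIsingPlusCorr Ω δ ![a, d] / rhoCHI δ * (meshIsingPlusCorr Ω δ ![a, d'] / rhoCHI δ) /
        (meshIsingPlusCorr Ω δ ![d, d'] / rhoCHI δ) / (1 - η),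
      ratioCHI (φ a) (φ d) * ratioCHI (φ a) (φ d') / ratioCHI (φ d) (φ d') / (1 - η),
      ?_, ?_, ?_, ?_⟩
    · rw [le_div_iff₀ h1η]; linarith
    · rw [div_le_iff₀ h1η]
      have : η₀ = 4 * η := by rw [hηdef]; ring
      rw [this]
      nlinarith
    · -- the limit of the comparison quantity: Thm 1.1 (`+`) thrice
      have h := ((hT1.mul hT2).div hT3 hτ3.ne').div_const (1 - η)
      have hLd0 := hLd.ne'
      have hLd'0 := hLd'.ne'
      have hR30 := hR3pos.ne'
      have h1η0 := h1η.ne'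
      have hval : twoPointPlusCHI φ a d * twoPointPlusCHI φ a d' / twoPointPlusCHI φ d d' / (1 - η) =
          onePointPlusCHI φ a ^ 2 *
            (ratioCHI (φ a) (φ d) * ratioCHI (φ a) (φ d') / ratioCHI (φ d) (φ d') / (1 - η)) := by
        rw [twoPointPlusCHI_eq_mul_ratioCHI hφa hφd, twoPointPlusCHI_eq_mul_ratioCHI hφa hφd',
          twoPointPlusCHI_eq_mul_ratioCHI hφd hφd']
        field_simp
      rw [hval] at h
      simp only [Pi.div_apply] at h
      exact h
    · -- the eventual two-sided bound
      filter_upwards [hdec1, hdec2, hdec3, eventually_mul_le_two hM ha hd had,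
        eventually_mul_le_two hM ha hd' had', eventually_mul_le_two hM hd hd' hdd']
        with δ h1 h2 h3 g1 g2 g3
      obtain ⟨l1, p1, hρpos⟩ := h1
      obtain ⟨l2, p2, -⟩ := h2
      obtain ⟨l3, p3, -⟩ := h3
      -- notation-free abbreviations
      set A := meshIsingPlusCorr Ω δ ![a] with hA
      set D := meshIsingPlusCorr Ω δ ![d] with hD
      set D' := meshIsingPlusCorr Ω δ ![d'] with hD'
      set P₁ := meshIsingPlusCorr Ω δ ![a, d] with hP₁
      set P₂ := meshIsingPlusCorr Ω δ ![a, d'] with hP₂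
      set P₃ := meshIsingPlusCorr Ω δ ![d, d'] with hP₃
      set ρ' := rhoCHI δ with hρ'
      have hDD' : 0 < D * D' := lt_of_lt_of_le (by positivity) l3
      have hAD : 0 < A * D := lt_of_lt_of_le (by positivity) l1
      have hAD' : 0 < A * D' := lt_of_lt_of_le (by positivity) l2
      have hD0 : D ≠ 0 := fun h => by rw [h, mul_zero] at hAD; exact lt_irrefl 0 hAD
      have hD'0 : D' ≠ 0 := fun h => by rw [h, mul_zero] at hAD'; exact lt_irrefl 0 hAD'
      have hA2 : A ^ 2 = A * D * (A * D') / (D * D') := by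
        rw [eq_div_iff hDD'.ne']
        ring
      -- upper bound `A² ≤ P₁ P₂ / ((1 - η) P₃)`
      have hup : A ^ 2 ≤ P₁ * P₂ / ((1 - η) * P₃) := by
        rw [hA2]
        calc A * D * (A * D') / (D * D') ≤ P₁ * P₂ / (D * D') :=
              div_le_div_of_nonneg_right (mul_le_mul g1 g2 hAD'.le (le_of_lt (lt_of_lt_of_le hAD g1))) hDD'.le
          _ ≤ P₁ * P₂ / ((1 - η) * P₃) :=
              div_le_div_of_nonneg_left (by positivity) (by positivity) l3
      -- lower bound `(1 - η)² P₁ P₂ / P₃ ≤ A²`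
      have hlo : (1 - η) ^ 2 * (P₁ * P₂) / P₃ ≤ A ^ 2 := by
        rw [hA2]
        calc (1 - η) ^ 2 * (P₁ * P₂) / P₃ ≤ (1 - η) ^ 2 * (P₁ * P₂) / (D * D') :=
              div_le_div_of_nonneg_left (by positivity) hDD' g3
          _ = (1 - η) * P₁ * ((1 - η) * P₂) / (D * D') := by ring
          _ ≤ A * D * (A * D') / (D * D') :=
              div_le_div_of_nonneg_right (mul_le_mul l1 l2 (by positivity) hAD.le) hDD'.le
      have hρinv : 0 < ρ'⁻¹ := inv_pos.2 hρpos
      constructor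
      · -- `(1 - η₀) B ≤ Q`
        have hB0 : 0 ≤ P₁ / ρ' * (P₂ / ρ') / (P₃ / ρ') / (1 - η) := by positivity
        have hpow : 1 - η₀ ≤ (1 - η) ^ 3 := by
          have : η₀ = 4 * η := by rw [hηdef]; ring
          rw [this]
          nlinarith [sq_nonneg η, hη0.le, hη1]
        calc (1 - η₀) * (P₁ / ρ' * (P₂ / ρ') / (P₃ / ρ') / (1 - η))
            ≤ (1 - η) ^ 3 * (P₁ / ρ' * (P₂ / ρ') / (P₃ / ρ') / (1 - η)) :=
              mul_le_mul_of_nonneg_right hpow hB0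
          _ = ρ'⁻¹ * ((1 - η) ^ 2 * (P₁ * P₂) / P₃) := by
              field_simp
          _ ≤ ρ'⁻¹ * A ^ 2 := mul_le_mul_of_nonneg_left hlo hρinv.le
      · -- `Q ≤ B`
        calc ρ'⁻¹ * A ^ 2 ≤ ρ'⁻¹ * (P₁ * P₂ / ((1 - η) * P₃)) := mul_le_mul_of_nonneg_left hup hρinv.le
          _ = P₁ / ρ' * (P₂ / ρ') / (P₃ / ρ') / (1 - η) := by
              field_simp
  -- Step 2: take square roots (`𝔼[σ_a] ≥ 0`, `ϱ ≥ 0`)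
  have hsqrt : Tendsto (fun δ => Real.sqrt ((rhoCHI δ)⁻¹ * meshIsingPlusCorr Ω δ ![a] ^ 2))
      (𝓝[>] 0) (𝓝 (onePointPlusCHI φ a)) := by
    have := hQ.sqrt
    rwa [Real.sqrt_sq hLa.le] at this
  refine hsqrt.congr' ?_
  filter_upwards [hAnn] with δ hA
  have hρ := rhoCHI_nonneg δ
  rw [Real.sqrt_mul (inv_nonneg.2 hρ), Real.sqrt_sq hA, Real.sqrt_inv, Real.sqrt_eq_rpow,
    ← Real.rpow_neg hρ]
  congr 1
  norm_num

/-- **CHI Theorem 1.3 (`k = 0`) from CHI Theorem 1.1, Proposition 2.20 (`k = 0`) and Lemma 2.26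
(`k = 1`)** — the step "`T₁ & L₁ ⇒ T₀`" of CHI's induction (§2.10, p. 20), globally: if for every
admissible `Ω` with `MeshApproximates Ω` and every conformal bijection `φ : Ω → ℍ`
* (`hT`, CHI Thm 1.1, `+` case, with the explicit limit (1.2)–(1.3))
  `𝔼⁺_{Ω_δ}[σ_aσ_c] / ϱ(δ) → ⟨σ_aσ_c⟩⁺_Ω` for distinct `a, c ∈ Ω`,
* (`hP`, CHI Prop 2.20 for `k = 0`, with `⟨σ_a⟩⁺_Ω` given by (1.2)–(1.3))
  `𝔼⁺_{Ω_δ}[σ_a] / 𝔼⁺_{Ω_δ}[σ_c] → ⟨σ_a⟩⁺_Ω / ⟨σ_c⟩⁺_Ω` for `a, c ∈ Ω`,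
* (`hL`, CHI Lemma 2.26 for `k = 1`, lower bound) for `a ∈ Ω` and `η > 0` there is `ε > 0` with
  `(1 - η) 𝔼⁺_{Ω_δ}[σ_cσ_a] ≤ 𝔼⁺_{Ω_δ}[σ_c] 𝔼⁺_{Ω_δ}[σ_a]` for small `δ`, whenever `c ∈ Ω` is
  within `ε` of `∂Ω`,
then `chi_onePoint_rho` holds. The three hypotheses are the published intermediate results of CHI on
which the printed proof of Thm 1.3 (`k = 0`) rests (their own proofs occupy CHI §§2.2–2.9 and §3);
they are hypotheses here, not named facts. [cite: ChelkakHonglerIzyurovAnnals2015, §2.10, proof of Thm. 1.3; Thm. 1.1, Prop. 2.20, Lemma 2.26] -/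
theorem chi_onePoint_rho_of_CHI
    (hT : ∀ (Ω : Set ℂ), IsAdmissibleDomain Ω → MeshApproximates Ω → ∀ (φ : ℂ → ℂ),
      IsConformalBijection φ Ω UpperHalfPlane.upperHalfPlaneSet → ∀ a ∈ Ω, ∀ c ∈ Ω, c ≠ a →
        Tendsto (fun δ => meshIsingPlusCorr Ω δ ![a, c] / rhoCHI δ) (𝓝[>] 0)
          (𝓝 (twoPointPlusCHI φ a c)))
    (hP : ∀ (Ω : Set ℂ), IsAdmissibleDomain Ω → MeshApproximates Ω → ∀ (φ : ℂ → ℂ),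
      IsConformalBijection φ Ω UpperHalfPlane.upperHalfPlaneSet → ∀ a ∈ Ω, ∀ c ∈ Ω,
        Tendsto (fun δ => meshIsingPlusCorr Ω δ ![a] / meshIsingPlusCorr Ω δ ![c]) (𝓝[>] 0)
          (𝓝 (onePointPlusCHI φ a / onePointPlusCHI φ c)))
    (hL : ∀ (Ω : Set ℂ), IsAdmissibleDomain Ω → MeshApproximates Ω → ∀ a ∈ Ω, ∀ η : ℝ, 0 < η →
      ∃ ε : ℝ, 0 < ε ∧ ∀ c ∈ Ω, Metric.infDist c Ωᶜ < ε →
        ∀ᶠ δ in 𝓝[>] (0 : ℝ), (1 - η) * meshIsingPlusCorr Ω δ ![c, a] ≤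
          meshIsingPlusCorr Ω δ ![c] * meshIsingPlusCorr Ω δ ![a]) :
    chi_onePoint_rho := by
  intro Ω hΩ hM φ hφ a ha
  exact tendsto_onePoint_rho_of_CHI hΩ hM hφ ha (hT Ω hΩ hM φ hφ a ha) (hP Ω hΩ hM φ hφ a ha)
    (hL Ω hΩ hM a ha)

/-- **CHI Theorem 1.3 (`k = 0`) from CHI Theorem 1.1 (`+` and free boundary conditions)
alone** — a strengthening of the step "`T₁ & L₁ ⇒ T₀`" of CHI's induction (§2.10) in which both
Lemma 2.26 and Prop 2.20 are dispensed with (two auxiliary boundary points, GHS and GKS, see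
`tendsto_onePoint_rho_of_twoPoint`): if for every admissible `Ω` with `MeshApproximates Ω`, every
conformal bijection `φ : Ω → ℍ` and all distinct `x, y ∈ Ω`
* (`hT`, CHI Thm 1.1, `+` case, explicit limit (1.2)–(1.3))
  `𝔼⁺_{Ω_δ}[σ_xσ_y] / ϱ(δ) → ⟨σ_xσ_y⟩⁺_Ω = twoPointPlusCHI φ x y`, and
* (`hTf`, CHI Thm 1.1, free case, explicit limit (1.2)–(1.3))
  `𝔼^free_{Ω_δ}[σ_xσ_y] / ϱ(δ) → ⟨σ_xσ_y⟩^free_Ω = twoPointFreeCHI φ x y`,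
then `chi_onePoint_rho` holds. The two remaining hypotheses are CHI's headline convergence theorem
for the two-point functions (pointwise form); its proof is the discrete-spinor-observable analysis
of CHI §§2.2–2.9 and §3, which the tree does not have.
[cite: ChelkakHonglerIzyurovAnnals2015, Thm. 1.1 and §2.10 (proofs of Lemma 2.26 and Thm. 1.3)] -/
theorem chi_onePoint_rho_of_twoPoint
    (hT : ∀ (Ω : Set ℂ), IsAdmissibleDomain Ω → MeshApproximates Ω → ∀ (φ : ℂ → ℂ),
      IsConformalBijection φ Ω UpperHalfPlane.upperHalfPlaneSet → ∀ x ∈ Ω, ∀ y ∈ Ω, x ≠ y →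
        Tendsto (fun δ => meshIsingPlusCorr Ω δ ![x, y] / rhoCHI δ) (𝓝[>] 0)
          (𝓝 (twoPointPlusCHI φ x y)))
    (hTf : ∀ (Ω : Set ℂ), IsAdmissibleDomain Ω → MeshApproximates Ω → ∀ (φ : ℂ → ℂ),
      IsConformalBijection φ Ω UpperHalfPlane.upperHalfPlaneSet → ∀ x ∈ Ω, ∀ y ∈ Ω, x ≠ y →
        Tendsto (fun δ => meshIsingFreeCorr Ω δ ![x, y] / rhoCHI δ) (𝓝[>] 0)
          (𝓝 (twoPointFreeCHI φ x y))) :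
    chi_onePoint_rho := by
  intro Ω hΩ hM φ hφ a ha
  exact tendsto_onePoint_rho_of_twoPoint hΩ hM hφ ha (hT Ω hΩ hM φ hφ) (hTf Ω hΩ hM φ hφ)

end Literature.Probability.LatticeModels
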